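import Literature.Analysis.FluidPDE.NSMollifiedL4
import Literature.Analysis.FluidPDE.SmoothLocalEnergy
import Literature.Analysis.FluidPDE.NSSuitableESS
import Mathlib.Analysis.Distribution.AEEqOfIntegralContDiff
import HarnessLib

/-!
# `L_{3,∞} ∩ L₂W¹₂` distributional solutions are suitable: proof of `NS.ess_suitable_of_L3infty'`

Analysis/FluidPDE proof file in the decomposition of the endpoint criterion
`Literature.Analysis.FluidPDE.ess_endpoint` (Escauriaza–Seregin–Šverák 2003, Thm. 1.3). It discharges the named fact
`NS.ess_suitable_of_L3infty'` (ESS, proof of Thm. 1.4, first paragraph: "we note that `v` and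
`p`, satisfying conditions (1.15) and (1.16), form a suitable weak solution to the Navier–Stokes
equations in `Q`. This can be verified with the help of usual mollification and the fact
`v ∈ L₄(Q)`"), stated over the corrected rendering `Fluid.IsESSSuitablePairOn` of ESS Def. 2.1
(`FluidPDE/NSSuitableESS`). The argument, carried out for a real inner product space `E` of
dimension `3`:

1. the hypotheses give `v ∈ L²∩L³(Q)`, `p ∈ L^{3/2}(Q)`, `∇v ∈ L²(Q)`, hence integrable zero
   extensions `ṽ = 𝟙_Q v`, `p̃`, `G̃` on `ℝ × E`, and `ṽ ∈ L⁴` of every interior box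
   (`FluidPDE/NSMollifiedL4`);
2. the space–time mollifications `Vₙ = kₙ ⋆ ṽ`, `Nₙᵢ = kₙ ⋆ (ṽᵢ ṽ)`, `Pₙ = kₙ ⋆ p̃` satisfy the
   mollified system pointwise in the interior (`FluidPDE/SpaceTimeMollifier`), so for a.e. time
   `t`, every nonnegative test function `φ` on `(-1, ∞) × B(0, 1)` and all large `n`, the smooth
   local energy identity holds (`FluidPDE/SmoothLocalEnergy`), together with the transport
   identity `2 ∫∫ φ ⟪DVₙ Vₙ, Vₙ⟫ = -∫∫ |Vₙ|² Vₙ·∇φ`;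
3. along a subsequence with sliced `L²` convergence at a.e. time, every term passes to the
   limit (`FluidPDE/MollifiedLimits`: products of `L^p`-convergent sequences; the nonlinear
   terms through the interior `L⁴` bound and the locality of mollification), giving the local
   energy **equality**, in particular the sliced local energy inequality (2.4).

## Main statements (all proved)

* `Fluid.HasWeakSpatialGradientOn.ae_eq` — weak spatial gradients on an open space–time region
  are a.e. unique (Evans, *PDE*, §5.2.1), so (2.4) does not depend on the gradient chosen;
* `Fluid.ae_localEnergyInequality_of_L3infty` — (2.4) for a.e. `t` and all `φ ≥ 0`, for pairs
  with (1.15)–(1.16) solving the system in the sense of distributions on `Q` (`dim E = 3`);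
* `NS.ess_suitable_of_L3infty'_holds : NS.ess_suitable_of_L3infty'`.
* `Fluid.IsSuitablePairOn.isESSSuitablePairOn` — comparison of the two renderings of Def. 2.1:
  when `1 ≤ |ω| < ∞` and `0 ≤ ν` the mis-parenthesised predicate `Fluid.IsSuitablePairOn` (whose
  left-hand side in (2.4) is `∫_ω φ|u|²(t) + |ω| · 2ν ∫∫ φ|∇u|²`, the slice `φ(t)|u(t)|²` being
  integrable on `ω` for a.e. `t` by (2.1) and the local integrability in (2.3)) implies the
  corrected `Fluid.IsESSSuitablePairOn`; on `B(1) × ]-1, 0[` (`|B(1)| = 4π/3`) this is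
  `Fluid.IsSuitablePairOn.isESSSuitablePairOn_unitBall`, whence the reduction
  `NS.ess_epsilon_regularity_of'` : `ess_epsilon_regularity' → ess_epsilon_regularity` — the
  accepted unprimed ε-regularity fact is a corollary of the faithful Lemma 2.2, as its docstring
  announces (the deep Lemma 2.2 itself, `ess_epsilon_regularity'`, is not proved here).

## Mathlib search

No Navier–Stokes notions in Mathlib; see the support files listed above for the generic tools.
The tree's accepted unprimed `NS.ess_suitable_of_L3infty` concludes `Fluid.IsSuitablePairOn`,
whose clause (2.4) is mis-parenthesised (see `FluidPDE/NSSuitableESS`); it is not proved here.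

## References

* L. Escauriaza, G. Seregin, V. Šverák, *`L_{3,∞}`-solutions of Navier–Stokes equations and
  backward uniqueness*, Russ. Math. Surveys 58:2 (2003), Def. 2.1, proof of Thm. 1.4, first
  paragraph.
* L. Caffarelli, R. Kohn, L. Nirenberg, *Partial regularity of suitable weak solutions of the
  Navier–Stokes equations*, CPAM 35 (1982), §2.
-/

noncomputable section

open MeasureTheory TopologicalSpace Set Function Filter Topology ContinuousLinearMap Metric
  InnerProductSpace Module
open scoped ENNReal NNReal Convolution RealInnerProductSpace Laplacian

namespace Literature.Analysis.FluidPDE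

section Prelim

variable {E : Type*} [NormedAddCommGroup E] [InnerProductSpace ℝ E] [FiniteDimensional ℝ E]
  [MeasurableSpace E] [BorelSpace E]
variable {F : Type*} [NormedAddCommGroup F]

/-! #### From sliced bounds to space–time classes on a cylinder -/

/-- A sliced `L^n` bound on `I × S` (`I` of finite measure) gives `∫∫_{I×S} ‖f‖^n ≤ C |I|`
(Tonelli, in the inequality form that needs no measurability). [folklore] -/
theorem setLIntegral_prod_le_of_slice_bound {f : ℝ × E → F} {I : Set ℝ} {S : Set E}
    {n : ℕ} {C : ℝ≥0∞} (h : ∀ᵐ t ∂(volume.restrict I), ∫⁻ y in S, ‖f (t, y)‖ₑ ^ n ≤ C) :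
    ∫⁻ z in I ×ˢ S, ‖f z‖ₑ ^ n ≤ C * volume I := by
  calc ∫⁻ z in I ×ˢ S, ‖f z‖ₑ ^ n
      = ∫⁻ z, ‖f z‖ₑ ^ n ∂((volume.restrict I).prod (volume.restrict S)) := by
        rw [Measure.prod_restrict, ← Measure.volume_eq_prod]
    _ ≤ ∫⁻ t in I, ∫⁻ y in S, ‖f (t, y)‖ₑ ^ n := lintegral_prod_le _
    _ ≤ ∫⁻ t in I, C := lintegral_mono_ae h
    _ = C * volume I := by rw [setLIntegral_const]

/-- **Sliced `L^n` bounds give the space–time class `L^n(I × S)`** for `I` of finite measure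
(`n ≥ 1` a natural number): `‖f‖_{L^n(I×S)}^n ≤ C |I| < ∞`. [folklore] -/
theorem memLp_of_slice_bound {f : ℝ × E → F} {I : Set ℝ} {S : Set E} (hI : volume I < ∞)
    (hf : AEStronglyMeasurable f (volume.restrict (I ×ˢ S))) {n : ℕ} (hn : n ≠ 0) {C : ℝ≥0∞}
    (hC : C < ∞) (h : ∀ᵐ t ∂(volume.restrict I), ∫⁻ y in S, ‖f (t, y)‖ₑ ^ n ≤ C) :
    MemLp f n (volume.restrict (I ×ˢ S)) := by
  refine ⟨hf, ?_⟩
  have h1 : eLpNorm f n (volume.restrict (I ×ˢ S)) ^ n < ∞ := by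
    rw [eLpNorm_natCast_pow_eq_lintegral' _ hn]
    exact (setLIntegral_prod_le_of_slice_bound h).trans_lt (ENNReal.mul_lt_top hC hI)
  by_contra htop
  rw [not_lt, top_le_iff] at htop
  rw [htop, ENNReal.top_pow hn] at h1
  exact lt_irrefl _ h1

omit [InnerProductSpace ℝ E] [FiniteDimensional ℝ E] [BorelSpace E] in
/-- `∫⁻ ‖f‖ₑ^{p} < ∞` (real exponent `p.toReal`) gives `f ∈ L^p`. [folklore] -/
theorem memLp_of_lintegral_rpow_lt_top {X : Type*} [MeasurableSpace X] {μ : Measure X}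
    {f : X → F} {p : ℝ≥0∞} (hp0 : p ≠ 0) (hptop : p ≠ ∞) (hf : AEStronglyMeasurable f μ)
    (h : ∫⁻ x, ‖f x‖ₑ ^ p.toReal ∂μ < ∞) : MemLp f p μ :=
  ⟨hf, (eLpNorm_lt_top_iff_lintegral_rpow_enorm_lt_top hp0 hptop).2 h⟩

omit [MeasurableSpace E] [BorelSpace E] in
/-- A square-integrable Frobenius norm gives `G ∈ L²` (operator norm `≤` Frobenius norm). [folklore] -/
theorem memLp_two_of_frobeniusNormSq {X : Type*} [MeasurableSpace X] {μ : Measure X}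
    {G : X → E →L[ℝ] E} (hG : AEStronglyMeasurable G μ)
    (h : ∫⁻ x, ENNReal.ofReal (frobeniusNormSq (G x)) ∂μ < ∞) : MemLp G 2 μ := by
  refine memLp_of_lintegral_rpow_lt_top two_ne_zero ENNReal.ofNat_ne_top hG ?_
  have h2 : (2 : ℝ≥0∞).toReal = 2 := by norm_num
  rw [h2]
  refine lt_of_le_of_lt (lintegral_mono fun x => ?_) h
  rw [ENNReal.rpow_two, ← ofReal_norm, ← ENNReal.ofReal_pow (norm_nonneg _)]
  exact ENNReal.ofReal_le_ofReal (sq_opNorm_le_frobeniusNormSq _)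

/-! #### Geometry of compact subsets of the unit cylinder -/

omit [MeasurableSpace E] [BorelSpace E] [FiniteDimensional ℝ E] in
/-- **Uniform margins.** A compact subset `K` of the open unit cylinder `(-1, 0) × B(0, 1)`
keeps a uniform distance `ε ∈ (0, 1]` from its boundary: `-1 < s - ε`, `s + ε < 0` and
`‖y‖ + ε < 1` for all `(s, y) ∈ K`. [folklore] -/
theorem exists_margin_of_isCompact [Nontrivial E] {K : Set (ℝ × E)} (hK : IsCompact K)
    (hKQ : K ⊆ Ioo (-1 : ℝ) 0 ×ˢ ball (0 : E) 1) :
    ∃ ε : ℝ, 0 < ε ∧ ε ≤ 1 ∧ ∀ z ∈ K, -1 < z.1 - ε ∧ z.1 + ε < 0 ∧ ‖z.2‖ + ε < 1 := by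
  obtain ⟨δ, hδ, hδK⟩ := hK.exists_cthickening_subset_open (isOpen_Ioo.prod isOpen_ball) hKQ
  refine ⟨min δ 1, lt_min hδ one_pos, min_le_right _ _, fun z hz => ?_⟩
  set ε := min δ 1 with hε
  have hεδ : ε ≤ δ := min_le_left _ _
  have hε0 : 0 < ε := lt_min hδ one_pos
  have hball : closedBall z ε ⊆ Ioo (-1 : ℝ) 0 ×ˢ ball (0 : E) 1 :=
    ((closedBall_subset_cthickening hz ε).trans (cthickening_mono hεδ K)).trans hδK
  have hmem : ∀ w : ℝ × E, dist w z ≤ ε → w ∈ Ioo (-1 : ℝ) 0 ×ˢ ball (0 : E) 1 :=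
    fun w hw => hball (mem_closedBall.2 hw)
  refine ⟨?_, ?_, ?_⟩
  · have h := hmem (z.1 - ε, z.2) (by
      rw [Prod.dist_eq, dist_self, Real.dist_eq]
      simp [abs_of_pos hε0, hε0.le])
    exact h.1.1
  · have h := hmem (z.1 + ε, z.2) (by
      rw [Prod.dist_eq, dist_self, Real.dist_eq]
      simp [abs_of_pos hε0, hε0.le])
    exact h.1.2
  · -- a point of `closedBall z ε` of norm `‖z.2‖ + ε`
    obtain ⟨y', hy'1, hy'2⟩ : ∃ y' : E, dist y' z.2 ≤ ε ∧ ‖y'‖ = ‖z.2‖ + ε := by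
      by_cases hz2 : z.2 = 0
      · obtain ⟨x, hx⟩ := exists_norm_eq E hε0.le
        exact ⟨x, by rw [hz2, dist_zero_right, hx], by rw [hz2, norm_zero, zero_add, hx]⟩
      · have hn : 0 < ‖z.2‖ := norm_pos_iff.2 hz2
        refine ⟨(1 + ε / ‖z.2‖) • z.2, ?_, ?_⟩
        · rw [dist_eq_norm, add_smul, one_smul, add_sub_cancel_left, norm_smul, norm_div,
            Real.norm_of_nonneg hε0.le, norm_norm, div_mul_cancel₀ _ hn.ne']
        · rw [norm_smul, Real.norm_of_nonneg (by positivity), add_mul, one_mul,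
            div_mul_cancel₀ _ hn.ne']
    have h := hmem (z.1, y') (by rw [Prod.dist_eq, dist_self]; simp [hy'1])
    have : ‖y'‖ < 1 := by simpa using h.2
    rwa [hy'2] at this

omit [MeasurableSpace E] [BorelSpace E] [FiniteDimensional ℝ E] [InnerProductSpace ℝ E] in
/-- With margins as in `exists_margin_of_isCompact`, balls of radius `≤ ε/2` about points of
`K` stay in the interior box `(-1 + ε/2, -ε/2) × B(0, 1 - ε/2)`. [folklore] -/
theorem closedBall_subset_box [NormedSpace ℝ E] {z : ℝ × E} {ε r : ℝ}
    (hz : -1 < z.1 - ε ∧ z.1 + ε < 0 ∧ ‖z.2‖ + ε < 1) (hr : r ≤ ε / 2) :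
    closedBall z r ⊆ Ioo (-1 + ε / 2) (-(ε / 2)) ×ˢ ball (0 : E) (1 - ε / 2) := by
  intro w hw
  rw [mem_closedBall, Prod.dist_eq, max_le_iff, Real.dist_eq, dist_eq_norm] at hw
  obtain ⟨h1, h2, h3⟩ := hz
  refine ⟨⟨?_, ?_⟩, ?_⟩
  · linarith [(abs_le.1 hw.1).1]
  · linarith [(abs_le.1 hw.1).2]
  · rw [mem_ball, dist_zero_right]
    calc ‖w.2‖ = ‖(w.2 - z.2) + z.2‖ := by rw [sub_add_cancel]
      _ ≤ ‖w.2 - z.2‖ + ‖z.2‖ := norm_add_le _ _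
      _ < 1 - ε / 2 := by linarith [hw.2]

omit [MeasurableSpace E] [BorelSpace E] [FiniteDimensional ℝ E] [InnerProductSpace ℝ E] in
/-- The interior box lies in the unit cylinder. [folklore] -/
theorem box_subset_unitCylinder [NormedSpace ℝ E] {ε : ℝ} (hε : 0 < ε) :
    Ioo (-1 + ε / 2) (-(ε / 2)) ×ˢ ball (0 : E) (1 - ε / 2) ⊆ Ioo (-1 : ℝ) 0 ×ˢ ball (0 : E) 1 :=
  prod_mono (Ioo_subset_Ioo (by linarith) (by linarith)) (ball_subset_ball (by linarith))

end Prelim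

/-! ### Uniqueness of weak spatial gradients on space–time regions -/

section Unique

variable {E : Type*} [NormedAddCommGroup E] [InnerProductSpace ℝ E] [FiniteDimensional ℝ E]
  [MeasurableSpace E] [BorelSpace E]

/-- **Weak spatial gradients are a.e. unique.** Two weak spatial gradients `G`, `G'` of the
same field `u` on an open space–time region `Q` agree a.e. on `Q` (subtract the two defining
identities to get `∫∫ φ ⟪(G - G') a, w⟫ = 0` for every test function `φ` on `Q`, apply the
fundamental lemma of the calculus of variations on the open set `Q ⊆ ℝ × E` — Mathlib's
`IsOpen.ae_eq_zero_of_integral_contDiff_smul_eq_zero` — and let `a`, `w` run through an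
orthonormal basis; Evans, *PDE*, §5.2.1, remark after the Definition). [cite: Evans2010, §5.2.1 (uniqueness of weak derivatives)] -/
theorem HasWeakSpatialGradientOn.ae_eq {Q : Opens (ℝ × E)} {u : ℝ → E → E}
    {G G' : ℝ → E → E →L[ℝ] E} (h : HasWeakSpatialGradientOn Q u G)
    (h' : HasWeakSpatialGradientOn Q u G') :
    ∀ᵐ z ∂(volume.restrict (Q : Set (ℝ × E))), uncurry G z = uncurry G' z := by
  set b := stdOrthonormalBasis ℝ E with hb
  have hQm : MeasurableSet (Q : Set (ℝ × E)) := Q.isOpen.measurableSet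
  -- the scalar differences `⟪w, (G - G') a⟫`
  have hd : ∀ a w : E, ∀ᵐ z ∂(volume : Measure (ℝ × E)), z ∈ (Q : Set (ℝ × E)) →
      ⟪w, uncurry G z a - uncurry G' z a⟫ = 0 := by
    intro a w
    have h1 : LocallyIntegrableOn (fun z : ℝ × E => uncurry G z a - uncurry G' z a)
        (Q : Set (ℝ × E)) volume :=
      (ContinuousLinearMap.apply ℝ E a).locallyIntegrableOn_comp
        (h.locallyIntegrableOn_grad.sub h'.locallyIntegrableOn_grad)
    have hloc : LocallyIntegrableOn (fun z : ℝ × E => ⟪w, uncurry G z a - uncurry G' z a⟫)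
        (Q : Set (ℝ × E)) volume := (innerSL ℝ w).locallyIntegrableOn_comp h1
    refine Q.isOpen.ae_eq_zero_of_integral_contDiff_smul_eq_zero hloc ?_
    intro Φ hΦ hΦc hΦs
    have hφ : IsSpaceTimeTestOn Q (curry Φ) := ⟨hΦ, hΦc, hΦs⟩
    have e := h.integral_fderiv_mul_inner_eq (curry Φ) hφ a w
    have e' := h'.integral_fderiv_mul_inner_eq (curry Φ) hφ a w
    have heq : ∫ t, ∫ x, curry Φ t x * ⟪G t x a, w⟫ = ∫ t, ∫ x, curry Φ t x * ⟪G' t x a, w⟫ := by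
      have h2 := e.symm.trans e'
      linarith [neg_inj.1 h2]
    obtain ⟨C, hC⟩ := hΦ.continuous.bounded_above_of_compact_support hΦc
    have hint : ∀ {H : ℝ → E → E →L[ℝ] E}, HasWeakSpatialGradientOn Q u H →
        Integrable (fun z : ℝ × E => Φ z * ⟪uncurry H z a, w⟫) (volume : Measure (ℝ × E)) := by
      intro H hH
      have h1 : IntegrableOn (fun z : ℝ × E => uncurry H z a) (tsupport Φ) volume :=
        (ContinuousLinearMap.apply ℝ E a).integrable_comp
          ((hH.locallyIntegrableOn_grad.mono_set hΦs).integrableOn_isCompact hΦc)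
      have hK : IntegrableOn (fun z : ℝ × E => ⟪uncurry H z a, w⟫) (tsupport Φ) volume :=
        h1.inner_const (𝕜 := ℝ) w
      have hK' : IntegrableOn (fun z : ℝ × E => Φ z * ⟪uncurry H z a, w⟫) (tsupport Φ) volume :=
        hK.bdd_mul hΦ.continuous.aestronglyMeasurable.restrict (Eventually.of_forall hC)
      refine (integrableOn_iff_integrable_of_support_subset ?_).1 hK'
      intro z hz
      refine subset_tsupport _ ?_
      rw [mem_support] at hz ⊢
      exact fun h0 => hz (by rw [h0, zero_mul])
    have hprod : ∀ {H : ℝ → E → E →L[ℝ] E}, HasWeakSpatialGradientOn Q u H →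
        ∫ t, ∫ x, curry Φ t x * ⟪H t x a, w⟫ = ∫ z, Φ z * ⟪uncurry H z a, w⟫ := by
      intro H hH
      have := integral_prod (fun z : ℝ × E => Φ z * ⟪uncurry H z a, w⟫)
        (by simpa [Measure.volume_eq_prod] using hint hH)
      rw [Measure.volume_eq_prod, this]
      rfl
    rw [hprod h, hprod h'] at heq
    have hsub : ∫ z, (Φ z * ⟪uncurry G z a, w⟫ - Φ z * ⟪uncurry G' z a, w⟫) = 0 := by
      rw [integral_sub (hint h) (hint h'), heq, sub_self]
    rw [← hsub]
    refine integral_congr_ae (Eventually.of_forall fun z => ?_)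
    simp only [smul_eq_mul, inner_sub_right, mul_sub, real_inner_comm w]
  -- combine over an orthonormal basis
  have hall : ∀ᵐ z ∂(volume : Measure (ℝ × E)), z ∈ (Q : Set (ℝ × E)) →
      ∀ i j, ⟪b j, uncurry G z (b i) - uncurry G' z (b i)⟫ = 0 := by
    have := ae_all_iff.2 fun i => ae_all_iff.2 fun j => hd (b i) (b j)
    filter_upwards [this] with z hz hzQ i j
    exact hz i j hzQ
  rw [ae_restrict_iff' hQm]
  filter_upwards [hall] with z hz hzQ
  have h0 : ∀ i, uncurry G z (b i) - uncurry G' z (b i) = 0 := fun i =>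
    ext_inner_left_basis b.toBasis fun j => by
      rw [inner_zero_right, OrthonormalBasis.coe_toBasis]
      exact hz hzQ i j
  refine ContinuousLinearMap.coe_injective (b.toBasis.ext fun i => ?_)
  simp only [ContinuousLinearMap.coe_coe, OrthonormalBasis.coe_toBasis]
  exact sub_eq_zero.1 (h0 i)

end Unique

/-! ### The local energy inequality of `L_{3,∞} ∩ L₂W¹₂` distributional solutions -/

section Main

variable {E : Type*} [NormedAddCommGroup E] [InnerProductSpace ℝ E] [FiniteDimensional ℝ E]
  [MeasurableSpace E] [BorelSpace E]

omit [FiniteDimensional ℝ E] [MeasurableSpace E] [BorelSpace E] in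
/-- The zero extension of `⟪v, e⟫ v` is `⟪ṽ, e⟫ ṽ`. [folklore] -/
theorem zeroExt_inner_smul {Q : Opens (ℝ × E)} (v : ℝ → E → E) (e : E) :
    zeroExt Q (fun t x => ⟪v t x, e⟫ • v t x) = fun z => ⟪zeroExt Q v z, e⟫ • zeroExt Q v z := by
  funext z
  by_cases hz : z ∈ (Q : Set (ℝ × E))
  · rw [zeroExt_of_mem _ hz, zeroExt_of_mem _ hz]
  · rw [zeroExt_of_not_mem _ hz, zeroExt_of_not_mem _ hz, inner_zero_left, zero_smul]

omit [InnerProductSpace ℝ E] [FiniteDimensional ℝ E] [MeasurableSpace E] [BorelSpace E] in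
/-- The zero extension from an open set with underlying set `S` is the indicator of `S`. [folklore] -/
theorem zeroExt_eq_indicator {F : Type*} [NormedAddCommGroup F] {Q : Opens (ℝ × E)}
    {S : Set (ℝ × E)} (hQ : (Q : Set (ℝ × E)) = S) (f : ℝ → E → F) :
    zeroExt Q f = S.indicator (uncurry f) := by
  rw [zeroExt, hQ]

/-- Space–time classes pass from the cylinder to the zero extension. [folklore] -/
theorem memLp_zeroExt {F : Type*} [NormedAddCommGroup F] {Q : Opens (ℝ × E)}
    {S : Set (ℝ × E)} (hQ : (Q : Set (ℝ × E)) = S) (hS : MeasurableSet S) {f : ℝ → E → F}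
    {q : ℝ≥0∞} (h : MemLp (uncurry f) q (volume.restrict S)) : MemLp (zeroExt Q f) q volume := by
  rw [zeroExt_eq_indicator hQ]
  exact (memLp_indicator_iff_restrict hS).2 h

/-- **Hölder triples from real arithmetic**: for positive reals with `a⁻¹ + b⁻¹ = c⁻¹`,
`(ofReal a, ofReal b, ofReal c)` is a Hölder triple in `ℝ≥0∞`. [folklore] -/
theorem holderTriple_ofReal {a b c : ℝ} (ha : 0 < a) (hb : 0 < b) (hc : 0 < c)
    (h : a⁻¹ + b⁻¹ = c⁻¹) :
    ENNReal.HolderTriple (ENNReal.ofReal a) (ENNReal.ofReal b) (ENNReal.ofReal c) := by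
  refine ⟨?_⟩
  rw [← ENNReal.ofReal_inv_of_pos ha, ← ENNReal.ofReal_inv_of_pos hb,
    ← ENNReal.ofReal_inv_of_pos hc, ← ENNReal.ofReal_add (by positivity) (by positivity), h]

/-- The Hölder triple `(2, 4, 4/3)`. [folklore] -/
theorem holderTriple_two_four : ENNReal.HolderTriple 2 4 (4 / 3) := by
  have h := holderTriple_ofReal (a := 2) (b := 4) (c := 4 / 3) (by norm_num) (by norm_num)
    (by norm_num) (by norm_num)
  rwa [ENNReal.ofReal_ofNat, ENNReal.ofReal_ofNat, ENNReal.ofReal_div_of_pos (by norm_num),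
    ENNReal.ofReal_ofNat, ENNReal.ofReal_ofNat] at h

/-- The Hölder triple `(4/3, 4, 1)`. [folklore] -/
theorem holderTriple_fourThirds_four : ENNReal.HolderTriple (4 / 3) 4 1 := by
  have h := holderTriple_ofReal (a := 4 / 3) (b := 4) (c := 1) (by norm_num) (by norm_num)
    (by norm_num) (by norm_num)
  rwa [ENNReal.ofReal_ofNat, ENNReal.ofReal_div_of_pos (by norm_num), ENNReal.ofReal_ofNat,
    ENNReal.ofReal_ofNat, ENNReal.ofReal_one] at h

omit [InnerProductSpace ℝ E] [FiniteDimensional ℝ E] [MeasurableSpace E] [BorelSpace E] in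
/-- Off the space–time support, the space slice vanishes near the point. [folklore] -/
theorem notMem_tsupport_slice {F : Type*} [Zero F] [TopologicalSpace F] {φ : ℝ → E → F}
    {z : ℝ × E} (hz : z ∉ tsupport (uncurry φ)) : z.2 ∉ tsupport (φ z.1) := by
  intro h
  have hsub : tsupport (φ z.1) ⊆ Prod.mk z.1 ⁻¹' tsupport (uncurry φ) := by
    refine closure_minimal (fun y hy => subset_tsupport _ ?_) ?_
    · exact hy
    · exact (isClosed_tsupport _).preimage (Continuous.prodMk_right z.1)
  exact hz (hsub h)

omit [InnerProductSpace ℝ E] [FiniteDimensional ℝ E] [MeasurableSpace E] [BorelSpace E] in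
/-- Off the space–time support, the time line vanishes near the point. [folklore] -/
theorem notMem_tsupport_timeLine {F : Type*} [Zero F] [TopologicalSpace F] {φ : ℝ → E → F}
    {z : ℝ × E} (hz : z ∉ tsupport (uncurry φ)) : z.1 ∉ tsupport (fun s => φ s z.2) := by
  intro h
  have hsub : tsupport (fun s => φ s z.2) ⊆ (fun s => (s, z.2)) ⁻¹' tsupport (uncurry φ) := by
    refine closure_minimal (fun s hs => subset_tsupport _ ?_) ?_
    · exact hs
    · exact (isClosed_tsupport _).preimage (Continuous.prodMk_left z.2)
  exact hz (hsub h)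

omit [MeasurableSpace E] [BorelSpace E] in
/-- All the weights built from a test function vanish off its space–time support:
`φ`, `∇φ`, `Δφ` and `∂ₜφ`. [folklore] -/
theorem weights_eq_zero_of_notMem_tsupport {φ : ℝ → E → ℝ} {z : ℝ × E}
    (hz : z ∉ tsupport (uncurry φ)) :
    φ z.1 z.2 = 0 ∧ gradient (φ z.1) z.2 = 0 ∧ (Δ (φ z.1)) z.2 = 0 ∧ timeDeriv φ z.1 z.2 = 0 := by
  refine ⟨image_eq_zero_of_notMem_tsupport (notMem_tsupport_slice hz),
    gradient_eq_zero_of_notMem_tsupport (notMem_tsupport_slice hz),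
    laplacian_eq_zero_of_notMem_tsupport (notMem_tsupport_slice hz), ?_⟩
  rw [timeDeriv_apply]
  have h := notMem_tsupport_timeLine hz
  -- the time line vanishes on a neighbourhood of `z.1`
  have : (fun s => φ s z.2) =ᶠ[𝓝 z.1] fun _ => 0 := notMem_tsupport_iff_eventuallyEq.1 h
  rw [this.deriv_eq, deriv_const]

omit [InnerProductSpace ℝ E] [FiniteDimensional ℝ E] [MeasurableSpace E] [BorelSpace E] in
/-- Slices of compactly supported space–time fields are compactly supported. [folklore] -/
theorem hasCompactSupport_slice_of_uncurry {F : Type*} [Zero F] [TopologicalSpace F]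
    {f : ℝ → E → F} (h : HasCompactSupport (uncurry f)) (t : ℝ) : HasCompactSupport (f t) := by
  refine (h.image continuous_snd).of_isClosed_subset (isClosed_tsupport _) ?_
  refine closure_minimal (fun x hx => ⟨(t, x), subset_tsupport _ hx, rfl⟩)
    (h.image continuous_snd).isClosed

omit [MeasurableSpace E] [BorelSpace E] in
/-- The zero extension of a field from a bounded open set has compact support. [folklore] -/
theorem hasCompactSupport_zeroExt {F : Type*} [NormedAddCommGroup F] {Q : Opens (ℝ × E)}
    (hQ : Bornology.IsBounded (Q : Set (ℝ × E))) (f : ℝ → E → F) :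
    HasCompactSupport (zeroExt Q f) :=
  HasCompactSupport.intro' hQ.isCompact_closure isClosed_closure fun _ hz =>
    indicator_of_notMem (fun h => hz (subset_closure h)) _

set_option maxHeartbeats 800000 in
/-- **The local energy inequality for `L_{3,∞} ∩ L₂W¹₂` distributional solutions**
(Escauriaza–Seregin–Šverák 2003, proof of Thm. 1.4, first paragraph). Let `dim E = 3`,
`Q = (-1, 0) × B(0, 1)`, `(v, p)` a distributional solution (viscosity `1`, no force) in `Q` with
(1.15) `v ∈ L_{2,∞}(Q)`, a square-integrable weak spatial gradient `G` on `Q`, `p ∈ L_{3/2}(Q)`,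
and (1.16) `v ∈ L_{3,∞}(Q)`. Then the sliced local energy inequality (2.4) holds (with equality):
for a.e. `t ∈ (-1, 0)` and every nonnegative test function `φ` on `(-1, ∞) × B(0, 1)`,
`∫_B φ|v|²(t) + 2 ∫_{-1}^t ∫_B φ |∇v|² ≤ ∫_{-1}^t ∫_B (|v|² (Δφ + ∂ₜφ) + v·∇φ (|v|² + 2p))`.
Proof ("usual mollification and the fact `v ∈ L₄(Q)`"): mollify in space–time, write the local
energy identity for the smooth mollified system (`local_energy_identity_smooth`), and pass to
the limit using `v ∈ L⁴_loc(Q)` (`lintegral_pow_four_interior_lt_top`). [cite: EscauriazaSereginSverak2003, §3, proof of Thm. 1.4, first paragraph] -/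
theorem ae_localEnergyInequality_of_L3infty (hE : finrank ℝ E = 3) {ω : Opens E}
    (hω : (ω : Set E) = ball (0 : E) 1) {v : ℝ → E → E} {p : ℝ → E → ℝ}
    {G : ℝ → E → E →L[ℝ] E}
    (hNS : IsDistributionalNSSolutionOn (parabolicCylinderOpens 1 ((0 : ℝ), (0 : E))) 1 0 v p)
    (h2 : ∃ C : ℝ≥0, ∀ᵐ t ∂(volume.restrict (Ioo (-1 : ℝ) 0)),
      ∫⁻ x in ball (0 : E) 1, ‖v t x‖ₑ ^ 2 ≤ C)
    (hG : HasWeakSpatialGradientOn (parabolicCylinderOpens 1 ((0 : ℝ), (0 : E))) v G)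
    (hG2 : ∫⁻ z in parabolicCylinder 1 ((0 : ℝ), (0 : E)),
      ENNReal.ofReal (frobeniusNormSq (G z.1 z.2)) < ∞)
    (hp : ∫⁻ z in parabolicCylinder 1 ((0 : ℝ), (0 : E)), ‖p z.1 z.2‖ₑ ^ (3 / 2 : ℝ) < ∞)
    (h3 : ∃ C : ℝ≥0, ∀ᵐ t ∂(volume.restrict (Ioo (-1 : ℝ) 0)),
      ∫⁻ x in ball (0 : E) 1, ‖v t x‖ₑ ^ 3 ≤ C) :
    ∀ᵐ t ∂(volume.restrict (Ioo (-1 : ℝ) 0)), ∀ φ : ℝ → E → ℝ,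
      IsSpaceTimeTestOn (forwardCylinder ω (-1)) φ → (∀ s y, 0 ≤ φ s y) →
      (∫ x in (ω : Set E), φ t x * ‖v t x‖ ^ 2) +
          2 * (1 : ℝ) * (∫ z in Ioo (-1 : ℝ) t ×ˢ (ω : Set E),
            φ z.1 z.2 * frobeniusNormSq (G z.1 z.2)) ≤
        ∫ z in Ioo (-1 : ℝ) t ×ˢ (ω : Set E),
          (‖v z.1 z.2‖ ^ 2 * ((1 : ℝ) * (Δ (φ z.1)) z.2 + timeDeriv φ z.1 z.2) +
            ⟪v z.1 z.2, gradient (φ z.1) z.2⟫ * (‖v z.1 z.2‖ ^ 2 + 2 * p z.1 z.2)) := by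
  haveI : Nontrivial E := Module.nontrivial_of_finrank_pos (R := ℝ) (by rw [hE]; norm_num)
  -- small constants in `ℝ≥0∞`
  have one_le_three_halves : (1 : ℝ≥0∞) ≤ 3 / 2 := by
    have h : (1 : ℝ≥0∞) = 2 / 2 := (ENNReal.div_self two_ne_zero ENNReal.ofNat_ne_top).symm
    rw [h]
    gcongr
    norm_num
  have three_halves_ne_top : (3 / 2 : ℝ≥0∞) ≠ ∞ := ENNReal.div_ne_top (by norm_num) (by norm_num)
  have three_halves_ne_zero : (3 / 2 : ℝ≥0∞) ≠ 0 :=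
    (ENNReal.div_pos (by norm_num) (by norm_num)).ne'
  haveI : (volume : Measure (ℝ × E)).IsAddHaarMeasure := Measure.prod.instIsAddHaarMeasure _ _
  set b := stdOrthonormalBasis ℝ E with hb
  -- ## (0) the cylinder and the space–time classes of `v`, `p`, `G`
  set Qo : Opens (ℝ × E) := parabolicCylinderOpens 1 ((0 : ℝ), (0 : E)) with hQo
  have hQ : (Qo : Set (ℝ × E)) = Ioo (-1 : ℝ) 0 ×ˢ ball (0 : E) 1 := by
    rw [hQo, coe_parabolicCylinderOpens, parabolicCylinder_one_zero]
  have hQ' : parabolicCylinder 1 ((0 : ℝ), (0 : E)) = Ioo (-1 : ℝ) 0 ×ˢ ball (0 : E) 1 :=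
    parabolicCylinder_one_zero
  rw [hQ'] at hG2 hp
  have hQm : MeasurableSet (Ioo (-1 : ℝ) 0 ×ˢ ball (0 : E) 1) :=
    measurableSet_Ioo.prod measurableSet_ball
  have hIfin : volume (Ioo (-1 : ℝ) 0) < ∞ := measure_Ioo_lt_top
  haveI : IsFiniteMeasure (volume.restrict (Ioo (-1 : ℝ) 0 ×ˢ ball (0 : E) 1)) := by
    refine ⟨?_⟩
    rw [Measure.restrict_apply_univ, Measure.volume_eq_prod, Measure.prod_prod]
    exact ENNReal.mul_lt_top measure_Ioo_lt_top measure_ball_lt_top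
  obtain ⟨C₂, h2⟩ := h2
  obtain ⟨C₃, h3⟩ := h3
  -- measurability on `Q`
  have hvm : AEStronglyMeasurable (uncurry v) (volume.restrict (Ioo (-1 : ℝ) 0 ×ˢ ball (0 : E) 1)) := by
    have := hNS.1.aestronglyMeasurable; rwa [hQ] at this
  have hpm : AEStronglyMeasurable (uncurry p) (volume.restrict (Ioo (-1 : ℝ) 0 ×ˢ ball (0 : E) 1)) := by
    have := hNS.2.2.1.aestronglyMeasurable; rwa [hQ] at this
  have hGm : AEStronglyMeasurable (uncurry G) (volume.restrict (Ioo (-1 : ℝ) 0 ×ˢ ball (0 : E) 1)) := by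
    have := hG.locallyIntegrableOn_grad.aestronglyMeasurable; rwa [hQ] at this
  -- the classes
  have hv2Q : MemLp (uncurry v) 2 (volume.restrict (Ioo (-1 : ℝ) 0 ×ˢ ball (0 : E) 1)) :=
    memLp_of_slice_bound hIfin hvm two_ne_zero ENNReal.coe_lt_top (n := 2) (by exact_mod_cast h2)
  have hv3Q : MemLp (uncurry v) 3 (volume.restrict (Ioo (-1 : ℝ) 0 ×ˢ ball (0 : E) 1)) :=
    memLp_of_slice_bound hIfin hvm (by norm_num) ENNReal.coe_lt_top (n := 3) (by exact_mod_cast h3)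
  have hpQ : MemLp (uncurry p) (3 / 2) (volume.restrict (Ioo (-1 : ℝ) 0 ×ˢ ball (0 : E) 1)) := by
    refine memLp_of_lintegral_rpow_lt_top three_halves_ne_zero three_halves_ne_top hpm ?_
    have : ((3 : ℝ≥0∞) / 2).toReal = 3 / 2 := by
      rw [ENNReal.toReal_div]; norm_num
    rw [this]
    exact hp
  have hGQ : MemLp (uncurry G) 2 (volume.restrict (Ioo (-1 : ℝ) 0 ×ˢ ball (0 : E) 1)) :=
    memLp_two_of_frobeniusNormSq hGm hG2
  -- integrability on `Q`
  have hvI : IntegrableOn (uncurry v) (Ioo (-1 : ℝ) 0 ×ˢ ball (0 : E) 1) volume :=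
    hv2Q.integrable one_le_two
  have hv2I : IntegrableOn (fun z => ‖uncurry v z‖ ^ 2) (Ioo (-1 : ℝ) 0 ×ˢ ball (0 : E) 1)
      volume := by
    exact hv2Q.integrable_norm_pow two_ne_zero
  have hpI : IntegrableOn (uncurry p) (Ioo (-1 : ℝ) 0 ×ˢ ball (0 : E) 1) volume :=
    hpQ.integrable one_le_three_halves
  have hGI : IntegrableOn (uncurry G) (Ioo (-1 : ℝ) 0 ×ˢ ball (0 : E) 1) volume :=
    hGQ.integrable one_le_two
  have hvI' : IntegrableOn (uncurry v) (Qo : Set (ℝ × E)) volume := by rwa [hQ]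
  have hv2I' : IntegrableOn (fun z => ‖uncurry v z‖ ^ 2) (Qo : Set (ℝ × E)) volume := by rwa [hQ]
  have hpI' : IntegrableOn (uncurry p) (Qo : Set (ℝ × E)) volume := by rwa [hQ]
  have hGI' : IntegrableOn (uncurry G) (Qo : Set (ℝ × E)) volume := by rwa [hQ]
  -- ## (1) the zero extensions and their whole-space classes
  set ũ : ℝ × E → E := zeroExt Qo v with hũ
  set pt : ℝ × E → ℝ := zeroExt Qo p with hpt
  set Gt : ℝ × E → E →L[ℝ] E := zeroExt Qo G with hGt
  have hũ2 : MemLp ũ 2 volume := memLp_zeroExt hQ hQm hv2Q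
  have hũ3 : MemLp ũ 3 volume := memLp_zeroExt hQ hQm hv3Q
  have hpt32 : MemLp pt (3 / 2) volume := memLp_zeroExt hQ hQm hpQ
  have hGt2 : MemLp Gt 2 volume := memLp_zeroExt hQ hQm hGQ
  have hũi : LocallyIntegrable ũ volume := locallyIntegrable_zeroExt hvI'
  have hpti : LocallyIntegrable pt volume := locallyIntegrable_zeroExt hpI'
  have hGti : LocallyIntegrable Gt volume := locallyIntegrable_zeroExt hGI'
  -- the sliced `L³` bound of `ũ` (real exponent)
  have h3t : ∀ᵐ s : ℝ, ∫⁻ y, ‖ũ (s, y)‖ₑ ^ (3 : ℝ) ≤ C₃ := by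
    have h3'' : ∀ᵐ s : ℝ, s ∈ Ioo (-1 : ℝ) 0 → ∫⁻ x in ball (0 : E) 1, ‖v s x‖ₑ ^ 3 ≤ C₃ :=
      (ae_restrict_iff' measurableSet_Ioo).1 h3
    filter_upwards [h3''] with s hs
    by_cases hs' : s ∈ Ioo (-1 : ℝ) 0
    · have e1 : ∀ y, ‖ũ (s, y)‖ₑ ^ (3 : ℝ) =
          (ball (0 : E) 1).indicator (fun y => ‖v s y‖ₑ ^ 3) y := fun y => by
        rw [hũ, zeroExt_eq_indicator hQ, ENNReal.rpow_ofNat]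
        by_cases hy : y ∈ ball (0 : E) 1
        · rw [indicator_of_mem (mk_mem_prod hs' hy), indicator_of_mem hy]; rfl
        · rw [indicator_of_notMem (fun h => hy h.2), indicator_of_notMem hy]; simp
      simp_rw [e1]
      rw [lintegral_indicator measurableSet_ball]
      exact hs hs'
    · have e1 : ∀ y, ‖ũ (s, y)‖ₑ ^ (3 : ℝ) = 0 := fun y => by
        rw [hũ, zeroExt_eq_indicator hQ, indicator_of_notMem (fun h => hs' h.1)]; simp
      simp_rw [e1]
      rw [lintegral_zero]
      exact zero_le
  -- ## (2) the mollifiers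
  obtain ⟨bump, hbr, -⟩ := FunctionSpaces.exists_contDiffBump_seq (E := ℝ × E)
  set k : ℕ → ℝ × E → ℝ := fun n => (bump n).normed volume with hk
  have hkinf : ∀ n, ContDiff ℝ (⊤ : ℕ∞) (k n) := fun n => (bump n).contDiff_normed
  have hkr : ∀ n w, w ∉ closedBall (0 : ℝ × E) (bump n).rOut → k n w = 0 := fun n w hw => by
    have : w ∉ Function.support (k n) := by
      rw [hk, (bump n).support_normed_eq]; exact fun h => hw (ball_subset_closedBall h)
    simpa using this
  have hkc : ∀ n, HasCompactSupport (k n) := fun n => (bump n).hasCompactSupport_normed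
  set V : ℕ → ℝ → E → E := fun n => stMollify (k n) ũ with hV
  set Pm : ℕ → ℝ → E → ℝ := fun n => stMollify (k n) pt with hPm
  set Gm : ℕ → ℝ → E → (E →L[ℝ] E) := fun n => stMollify (k n) Gt with hGm
  set Nt : Fin (finrank ℝ E) → ℝ × E → E := fun i => zeroExt Qo fun t x => ⟪v t x, b i⟫ • v t x
    with hNt
  have hNt' : ∀ i, Nt i = fun z => ⟪ũ z, b i⟫ • ũ z := fun i => by
    rw [hNt]; exact zeroExt_inner_smul v (b i)
  have hNti : ∀ i, IntegrableOn (uncurry fun t x => ⟪v t x, b i⟫ • v t x) (Qo : Set (ℝ × E))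
      volume := by
    intro i
    refine Integrable.mono' (hv2I'.mul_const ‖b i‖) ?_ (Eventually.of_forall fun z => ?_)
    · exact (hvI'.aestronglyMeasurable.inner aestronglyMeasurable_const).smul
        hvI'.aestronglyMeasurable
    · change ‖⟪v z.1 z.2, b i⟫ • v z.1 z.2‖ ≤ ‖uncurry v z‖ ^ 2 * ‖b i‖
      rw [norm_smul]
      calc ‖⟪v z.1 z.2, b i⟫‖ * ‖v z.1 z.2‖ ≤ (‖v z.1 z.2‖ * ‖b i‖) * ‖v z.1 z.2‖ := by
            gcongr; exact norm_inner_le_norm _ _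
        _ = ‖uncurry v z‖ ^ 2 * ‖b i‖ := by rw [show uncurry v z = v z.1 z.2 from rfl]; ring
  have hNtli : ∀ i, LocallyIntegrable (Nt i) volume := fun i => locallyIntegrable_zeroExt (hNti i)
  set N : ℕ → Fin (finrank ℝ E) → ℝ → E → E := fun n i => stMollify (k n) (Nt i) with hN
  -- smoothness and continuity of the mollified fields
  have hVsm : ∀ n, ContDiff ℝ (⊤ : ℕ∞) (uncurry (V n)) := fun n =>
    contDiff_uncurry_stMollify (hkinf n) (hkc n) hũi
  have hPsm : ∀ n, ContDiff ℝ (⊤ : ℕ∞) (uncurry (Pm n)) := fun n =>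
    contDiff_uncurry_stMollify (hkinf n) (hkc n) hpti
  have hNsm : ∀ n i, ContDiff ℝ (⊤ : ℕ∞) (uncurry (N n i)) := fun n i =>
    contDiff_uncurry_stMollify (hkinf n) (hkc n) (hNtli i)
  have hGsm : ∀ n, ContDiff ℝ (⊤ : ℕ∞) (uncurry (Gm n)) := fun n =>
    contDiff_uncurry_stMollify (hkinf n) (hkc n) hGti
  have hVc : ∀ n, Continuous (uncurry (V n)) := fun n => (hVsm n).continuous
  have hPc : ∀ n, Continuous (uncurry (Pm n)) := fun n => (hPsm n).continuous
  have hNc : ∀ n i, Continuous (uncurry (N n i)) := fun n i => (hNsm n i).continuous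
  have hGc : ∀ n, Continuous (uncurry (Gm n)) := fun n => (hGsm n).continuous
  -- whole-space convergence of the mollifications
  have cV2 : Tendsto (fun n => eLpNorm (uncurry (V n) - ũ) 2 volume) atTop (𝓝 0) :=
    FunctionSpaces.tendsto_eLpNorm_normed_convolution_sub_self hbr (by norm_num) (by norm_num) hũ2
  have cV3 : Tendsto (fun n => eLpNorm (uncurry (V n) - ũ) 3 volume) atTop (𝓝 0) :=
    FunctionSpaces.tendsto_eLpNorm_normed_convolution_sub_self hbr (by norm_num) (by norm_num) hũ3
  have cP : Tendsto (fun n => eLpNorm (uncurry (Pm n) - pt) (3 / 2) volume) atTop (𝓝 0) :=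
    FunctionSpaces.tendsto_eLpNorm_normed_convolution_sub_self hbr one_le_three_halves three_halves_ne_top hpt32
  have cG : Tendsto (fun n => eLpNorm (uncurry (Gm n) - Gt) 2 volume) atTop (𝓝 0) :=
    FunctionSpaces.tendsto_eLpNorm_normed_convolution_sub_self hbr (by norm_num) (by norm_num) hGt2
  -- whole-space classes of the mollifications
  have mV2 : ∀ n, MemLp (uncurry (V n)) 2 volume := fun n =>
    UnboundedOperators.memLp_convolution_lsmul (bump n).integrable_normed hũ2 (by norm_num)
  have mV3 : ∀ n, MemLp (uncurry (V n)) 3 volume := fun n =>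
    UnboundedOperators.memLp_convolution_lsmul (bump n).integrable_normed hũ3 (by norm_num)
  have mP : ∀ n, MemLp (uncurry (Pm n)) (3 / 2) volume := fun n =>
    UnboundedOperators.memLp_convolution_lsmul (bump n).integrable_normed hpt32 one_le_three_halves
  have mG : ∀ n, MemLp (uncurry (Gm n)) 2 volume := fun n =>
    UnboundedOperators.memLp_convolution_lsmul (bump n).integrable_normed hGt2 (by norm_num)
  -- ## (3) a subsequence with sliced `L²` convergence for a.e. time, and the good times
  obtain ⟨ns, hns, hsl⟩ := exists_subseq_tendsto_eLpNorm_slice (ν := (volume : Measure E))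
    (D := fun n z => V n z.1 z.2 - ũ z)
    (fun n => by
      rw [← Measure.volume_eq_prod]; exact ((mV2 n).sub hũ2).1)
    (fun n => by
      rw [← Measure.volume_eq_prod]; exact ((mV2 n).sub hũ2).eLpNorm_lt_top)
    (by rw [← Measure.volume_eq_prod]; exact cV2)
  have hfinslice : ∀ᵐ s : ℝ, ∫⁻ y, ‖ũ (s, y)‖ₑ ^ 2 < ∞ := by
    have hm : AEMeasurable (fun z : ℝ × E => ‖ũ z‖ₑ ^ 2)
        ((volume : Measure ℝ).prod (volume : Measure E)) := by
      rw [← Measure.volume_eq_prod]; exact hũ2.1.enorm.pow_const 2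
    refine ae_lt_top' hm.lintegral_prod_right' ?_
    rw [← lintegral_prod _ hm, ← Measure.volume_eq_prod, ← MollifiedLimits.eLpNorm_two_pow_two]
    exact ENNReal.pow_ne_top hũ2.eLpNorm_lt_top.ne
  have hmslice : ∀ᵐ s : ℝ, AEStronglyMeasurable (fun y => ũ (s, y)) volume := by
    set ũ' : ℝ × E → E := hũ2.1.mk ũ with hũ'
    have hsm : StronglyMeasurable ũ' := hũ2.1.stronglyMeasurable_mk
    have e : ũ =ᵐ[volume] ũ' := hũ2.1.ae_eq_mk
    rw [Measure.volume_eq_prod] at e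
    have h1 : ∀ᵐ s : ℝ, ∀ᵐ y : E, ũ (s, y) = ũ' (s, y) := Measure.ae_ae_eq_curry_of_prod e
    filter_upwards [h1] with s hs
    exact ⟨fun y => ũ' (s, y), hsm.comp_measurable measurable_prodMk_left, hs⟩
  have hbrs : Tendsto (fun j => (bump (ns j)).rOut) atTop (𝓝 0) := hbr.comp hns.tendsto_atTop
  -- compact support of the mollified velocity (for the slice at time `t`)
  have hQbdd : Bornology.IsBounded (Qo : Set (ℝ × E)) := by
    rw [hQ]
    exact (Metric.isBounded_Ioo (-1 : ℝ) 0).prod Metric.isBounded_ball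
  have hVcs : ∀ n, HasCompactSupport (uncurry (V n)) := fun n =>
    (hkc n).convolution _ (hasCompactSupport_zeroExt hQbdd v)
  -- ## (4) the good times
  filter_upwards [ae_restrict_mem measurableSet_Ioo, ae_restrict_of_ae hsl,
    ae_restrict_of_ae hfinslice, ae_restrict_of_ae hmslice] with t ht hts htf htm
  intro φ hφ hφ0
  -- ### (a) support geometry of `φ` below time `t`
  have hω' : ∀ {s : ℝ} {y : E}, φ s y ≠ 0 → -1 < s ∧ y ∈ ball (0 : E) 1 := fun {s y} h => by
    have hz : (s, y) ∈ (forwardCylinder ω (-1) : Set (ℝ × E)) :=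
      hφ.tsupport_subset (subset_tsupport _ (by exact h))
    rw [coe_forwardCylinder, hω] at hz
    exact ⟨hz.1, hz.2⟩
  obtain ⟨Kx, hKx, hKxt⟩ := hφ.exists_compact_slice_subset
  have hφKx : ∀ s, ∀ y ∉ Kx, φ s y = 0 := fun s y hy =>
    image_eq_zero_of_notMem_tsupport fun h => hy (hKxt s h)
  set Kt : Set (ℝ × E) := tsupport (uncurry φ) ∩ (Iic t ×ˢ univ) with hKt_def
  have hKt : IsCompact Kt := hφ.hasCompactSupport.inter_right (isClosed_Iic.prod isClosed_univ)
  have hKtQ : Kt ⊆ Ioo (-1 : ℝ) 0 ×ˢ ball (0 : E) 1 := by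
    rintro ⟨s, y⟩ ⟨h1, h2⟩
    have hz : (s, y) ∈ (forwardCylinder ω (-1) : Set (ℝ × E)) := hφ.tsupport_subset h1
    rw [coe_forwardCylinder, hω] at hz
    exact ⟨⟨hz.1, lt_of_le_of_lt h2.1 ht.2⟩, hz.2⟩
  have hmemKt : ∀ {s : ℝ} {y : E}, s < t → φ s y ≠ 0 → (s, y) ∈ Kt := fun {s y} hs h =>
    ⟨subset_tsupport _ (by exact h), ⟨hs.le, mem_univ _⟩⟩
  have hmemKt' : ∀ {s : ℝ} {y : E}, s ≤ t → (s, y) ∈ tsupport (uncurry φ) → (s, y) ∈ Kt :=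
    fun {s y} hs h => ⟨h, ⟨hs, mem_univ _⟩⟩
  obtain ⟨ε, hε, hε1, hmargin⟩ := exists_margin_of_isCompact hKt hKtQ
  set Q' : Set (ℝ × E) := Ioo (-1 + ε / 2) (-(ε / 2)) ×ˢ ball (0 : E) (1 - ε / 2) with hQ'_def
  have hQ'm : MeasurableSet Q' := measurableSet_Ioo.prod measurableSet_ball
  have hQ'Q : Q' ⊆ Ioo (-1 : ℝ) 0 ×ˢ ball (0 : E) 1 := box_subset_unitCylinder hε
  have hQ'Qo : Q' ⊆ (Qo : Set (ℝ × E)) := by rw [hQ]; exact hQ'Q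
  have hballKt : ∀ z ∈ Kt, ∀ r, r ≤ ε / 2 → closedBall z r ⊆ Q' := fun z hz r hr =>
    closedBall_subset_box (hmargin z hz) hr
  have hKtQ' : Kt ⊆ Q' := fun z hz => hballKt z hz 0 (by linarith) (mem_closedBall_self le_rfl)
  -- the interior `L⁴` bound and the localised fields
  have h4 : ∫⁻ z in Q', ‖ũ z‖ₑ ^ 4 < ∞ := by
    have := lintegral_pow_four_interior_lt_top hE hvI hũ2 ENNReal.coe_lt_top h3t hG hGI hGt2
      (ρ := 1 - ε / 2) (τ := ε / 2) (by linarith) (by linarith) (by linarith)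
    rwa [hQ'_def]
  set uQ : ℝ × E → E := Q'.indicator ũ with huQ
  have huQ4 : MemLp uQ 4 volume := by
    rw [huQ, memLp_indicator_iff_restrict hQ'm]
    refine ⟨hũ2.1.restrict, ?_⟩
    have h1 : eLpNorm ũ 4 (volume.restrict Q') ^ 4 < ∞ := by
      have e := eLpNorm_natCast_pow_eq_lintegral' (μ := volume.restrict Q') ũ (n := 4) (by norm_num)
      simp only [Nat.cast_ofNat] at e
      rw [e]; exact h4
    by_contra htop
    rw [not_lt, top_le_iff] at htop
    rw [htop, ENNReal.top_pow (by norm_num)] at h1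
    exact lt_irrefl _ h1
  have huQ2 : MemLp uQ 2 volume := by rw [huQ]; exact hũ2.indicator hQ'm
  have huQ3 : MemLp uQ 3 volume := by rw [huQ]; exact hũ3.indicator hQ'm
  set NQ : Fin (finrank ℝ E) → ℝ × E → E := fun i z => ⟪uQ z, b i⟫ • uQ z with hNQ
  haveI hHT442 : ENNReal.HolderTriple 4 4 2 := by
    simpa using holderTriple_ofReal (a := 4) (b := 4) (c := 2) (by norm_num) (by norm_num)
      (by norm_num) (by norm_num)
  haveI hHT24 : ENNReal.HolderTriple 2 4 (4 / 3) := holderTriple_two_four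
  haveI hHT41 : ENNReal.HolderTriple (4 / 3) 4 1 := holderTriple_fourThirds_four
  haveI hHT33 : ENNReal.HolderTriple 3 3 (3 / 2) := by
    have h := holderTriple_ofReal (a := 3) (b := 3) (c := 3 / 2) (by norm_num) (by norm_num)
      (by norm_num) (by norm_num)
    rwa [ENNReal.ofReal_ofNat, ENNReal.ofReal_div_of_pos (by norm_num), ENNReal.ofReal_ofNat,
      ENNReal.ofReal_ofNat] at h
  haveI hHT31 : ENNReal.HolderTriple (3 / 2) 3 1 := by
    have h := holderTriple_ofReal (a := 3 / 2) (b := 3) (c := 1) (by norm_num) (by norm_num)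
      (by norm_num) (by norm_num)
    rwa [ENNReal.ofReal_ofNat, ENNReal.ofReal_div_of_pos (by norm_num), ENNReal.ofReal_ofNat,
      ENNReal.ofReal_ofNat, ENNReal.ofReal_one] at h
  haveI hHT22 : ENNReal.HolderTriple 2 2 1 := ENNReal.HolderConjugate.instTwoTwo
  have hNQ2 : ∀ i, MemLp (NQ i) 2 volume := fun i => by
    have := memLp_bilin (p := 4) (q := 4) (r := 2) (innerSmulBilin (b i)) huQ4 huQ4
    simpa [hNQ] using this
  set VQ : ℕ → ℝ → E → E := fun n => stMollify (k n) uQ with hVQ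
  set NQm : ℕ → Fin (finrank ℝ E) → ℝ → E → E := fun n i => stMollify (k n) (NQ i) with hNQm
  have cVQ4 : Tendsto (fun n => eLpNorm (uncurry (VQ n) - uQ) 4 volume) atTop (𝓝 0) :=
    FunctionSpaces.tendsto_eLpNorm_normed_convolution_sub_self hbr (by norm_num) (by norm_num) huQ4
  have cNQ : ∀ i, Tendsto (fun n => eLpNorm (uncurry (NQm n i) - NQ i) 2 volume) atTop (𝓝 0) :=
    fun i => FunctionSpaces.tendsto_eLpNorm_normed_convolution_sub_self hbr (by norm_num) (by norm_num) (hNQ2 i)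
  have mVQ4 : ∀ n, MemLp (uncurry (VQ n)) 4 volume := fun n =>
    UnboundedOperators.memLp_convolution_lsmul (bump n).integrable_normed huQ4 (by norm_num)
  have mNQ : ∀ n i, MemLp (uncurry (NQm n i)) 2 volume := fun n i =>
    UnboundedOperators.memLp_convolution_lsmul (bump n).integrable_normed (hNQ2 i) (by norm_num)
  -- locality: on `Kt` the mollified fields only see `Q'`
  have hloc : ∀ n, (bump n).rOut ≤ ε / 2 → ∀ z ∈ Kt,
      V n z.1 z.2 = VQ n z.1 z.2 ∧ ∀ i, N n i z.1 z.2 = NQm n i z.1 z.2 := by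
    intro n hn z hz
    have hsub := hballKt z hz _ hn
    have e1 : EqOn ũ uQ (closedBall z (bump n).rOut) := fun w hw => by
      rw [huQ, indicator_of_mem (hsub hw)]
    have e2 : ∀ i, EqOn (Nt i) (NQ i) (closedBall z (bump n).rOut) := fun i w hw => by
      rw [hNt' i]
      simp only [hNQ, huQ, indicator_of_mem (hsub hw)]
    refine ⟨?_, fun i => ?_⟩
    · exact convolution_lsmul_congr_of_eqOn (hkr n) e1
    · exact convolution_lsmul_congr_of_eqOn (hkr n) (e2 i)
  -- ### (b) the mollified equations on `{φ ≠ 0}` below time `t`, and the energy identity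
  have hEQ : ∀ n, (bump n).rOut ≤ ε / 2 → ∀ s ∈ Ioo (-1 : ℝ) t, ∀ y, φ s y ≠ 0 →
      (∀ i, ⟪timeDeriv (V n) s y, b i⟫ + VectorCalculus.divergence (N n i s) y - 1 * ⟪(Δ (V n s)) y, b i⟫ +
        fderiv ℝ (Pm n s) y (b i) = 0) ∧
      VectorCalculus.divergence (V n s) y = 0 ∧ fderiv ℝ (V n s) y = Gm n s y := by
    intro n hn s hs y hy
    have hz : (s, y) ∈ Kt := hmemKt hs.2 hy
    have hsub : closedBall ((s, y) : ℝ × E) (bump n).rOut ⊆ (Qo : Set (ℝ × E)) :=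
      (hballKt _ hz _ hn).trans hQ'Qo
    exact ⟨fun i => hNS.mollified_momentum hvI' hv2I' hpI' (hkinf n) (hkr n) hsub (b i),
      hNS.divergence_mollified_eq_zero hvI' (hkinf n) (hkr n) hsub,
      hG.fderiv_mollified hvI' hGI' (hkinf n) (hkr n) hsub⟩
  have hφa : ∀ y, φ (-1) y = 0 := fun y => by
    by_contra h
    exact lt_irrefl _ (hω' h).1
  have hID : ∀ n, (bump n).rOut ≤ ε / 2 →
      (∫ y, φ t y * ‖V n t y‖ ^ 2) + 2 * (1 : ℝ) * ∫ z in Ioo (-1 : ℝ) t ×ˢ (univ : Set E),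
          φ z.1 z.2 * frobeniusNormSq (fderiv ℝ (V n z.1) z.2) =
      ∫ z in Ioo (-1 : ℝ) t ×ˢ (univ : Set E), (‖V n z.1 z.2‖ ^ 2 * ((1 : ℝ) * (Δ (φ z.1)) z.2 +
        timeDeriv φ z.1 z.2) +
        2 * (∑ i, (⟪N n i z.1 z.2, gradient (φ z.1) z.2⟫ * ⟪V n z.1 z.2, b i⟫ +
          φ z.1 z.2 * ⟪fderiv ℝ (V n z.1) z.2 (N n i z.1 z.2), b i⟫)) +
        2 * (Pm n z.1 z.2 * ⟪V n z.1 z.2, gradient (φ z.1) z.2⟫)) := fun n hn =>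
    local_energy_identity_smooth b (ν := 1) ht.1.le (hVsm n) (hNsm n) (hPsm n) hφ hφa
      (fun s hs y hy => (hEQ n hn s hs y hy).1) (fun s hs y hy => (hEQ n hn s hs y hy).2.1)
  -- ### (c) the transport identity `2 ∫∫ φ ⟪G V, V⟫ = -∫∫ |V|² ⟪V, ∇φ⟫`
  have sφ : IsSmoothSpaceTimeOn univ φ := hφ.isSmoothSpaceTimeOn univ
  have cφ : Continuous (uncurry φ) := hφ.contDiff.continuous
  have cgφ : Continuous (uncurry fun s y => gradient (φ s) y) :=
    (sφ.gradient uniqueDiffOn_univ).continuous_uncurry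
  have cΔφ : Continuous (uncurry fun s y => (Δ (φ s)) y) :=
    (sφ.laplacian uniqueDiffOn_univ).continuous_uncurry
  have cTφ : Continuous (uncurry (timeDeriv φ)) := hφ.continuous_timeDeriv
  have hg0 : ∀ s, ∀ y ∉ Kx, gradient (φ s) y = 0 := fun s y hy =>
    gradient_eq_zero_of_notMem_tsupport fun h => hy (hKxt s h)
  have hΔ0 : ∀ s, ∀ y ∉ Kx, (Δ (φ s)) y = 0 := fun s y hy =>
    laplacian_eq_zero_of_notMem_tsupport fun h => hy (hKxt s h)
  have hT0 : ∀ s, ∀ y ∉ Kx, timeDeriv φ s y = 0 := fun s y hy =>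
    timeDeriv_eq_zero_of_forall (fun s' => hφKx s' y hy) s
  have hDAG : ∀ n, (bump n).rOut ≤ ε / 2 →
      2 * ∫ z in Ioo (-1 : ℝ) t ×ˢ (univ : Set E),
          φ z.1 z.2 * ⟪Gm n z.1 z.2 (V n z.1 z.2), V n z.1 z.2⟫ =
      -∫ z in Ioo (-1 : ℝ) t ×ˢ (univ : Set E),
          ‖V n z.1 z.2‖ ^ 2 * ⟪V n z.1 z.2, gradient (φ z.1) z.2⟫ := by
    intro n hn
    -- continuity and `x`-support of both integrands
    have cL : Continuous fun z : ℝ × E => φ z.1 z.2 * ⟪Gm n z.1 z.2 (V n z.1 z.2), V n z.1 z.2⟫ :=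
      cφ.mul ((isBoundedBilinearMap_apply.continuous.comp ((hGc n).prodMk (hVc n))).inner (hVc n))
    have cR : Continuous fun z : ℝ × E => ‖V n z.1 z.2‖ ^ 2 * ⟪V n z.1 z.2, gradient (φ z.1) z.2⟫ :=
      ((hVc n).norm.pow 2).mul ((hVc n).inner cgφ)
    have iL := integrable_prod_of_continuousOn (a := -1) (b := t) hKx cL.continuousOn
      (fun s _ y hy => by simp only [hφKx s y hy, zero_mul])
    have iR := integrable_prod_of_continuousOn (a := -1) (b := t) hKx cR.continuousOn
      (fun s _ y hy => by simp only [hg0 s y hy, inner_zero_right, mul_zero])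
    -- the slice identity
    have hsl' : ∀ s ∈ Ioo (-1 : ℝ) t, 2 * ∫ y, φ s y * ⟪Gm n s y (V n s y), V n s y⟫ =
        -∫ y, ‖V n s y‖ ^ 2 * ⟪V n s y, gradient (φ s) y⟫ := by
      intro s hs
      have hV1 : ContDiff ℝ 1 (V n s) :=
        (contDiff_stMollify_slice (hkinf n) (hkc n) hũi s).of_le one_le_infty
      have hφ1 : ContDiff ℝ 1 (φ s) :=
        (IsSpaceTimeTestOn.contDiff_slice hφ s).of_le one_le_infty
      have key := two_mul_integral_mul_inner_fderiv_self hV1 hφ1 (hφ.hasCompactSupport_slice s)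
        (fun y hy => (hEQ n hn s hs y hy).2.1)
      rw [← key]
      congr 1
      refine integral_congr_ae (Eventually.of_forall fun y => ?_)
      dsimp only
      by_cases hy : φ s y = 0
      · simp only [hy, zero_mul]
      · rw [(hEQ n hn s hs y hy).2.2]
    rw [setIntegral_prod_univ_eq iL, setIntegral_prod_univ_eq iR, ← integral_neg, ← integral_const_mul]
    refine setIntegral_congr_fun measurableSet_Ioo fun s hs => ?_
    exact hsl' s hs
  -- ### (d) passage to the limit along `ns`
  set S : Set (ℝ × E) := Ioo (-1 : ℝ) t ×ˢ (univ : Set E) with hS_def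
  -- the weights and their bounds
  set wΔ : ℝ × E → ℝ := fun z => (1 : ℝ) * (Δ (φ z.1)) z.2 + timeDeriv φ z.1 z.2 with hwΔ
  set wφ : ℝ × E → ℝ := fun z => φ z.1 z.2 with hwφ
  set wg : ℝ × E → E →L[ℝ] ℝ := fun z => innerSL ℝ (gradient (φ z.1) z.2) with hwg
  have cwΔ : Continuous wΔ := (continuous_const.mul cΔφ).add cTφ
  have cwg : Continuous wg := (innerSL ℝ).continuous.comp cgφ
  have hsuppφ : HasCompactSupport (uncurry φ) := hφ.hasCompactSupport
  have hw0 : ∀ z, z ∉ tsupport (uncurry φ) → wφ z = 0 ∧ wg z = 0 ∧ wΔ z = 0 := fun z hz => by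
    obtain ⟨h1, h2, h3, h4⟩ := weights_eq_zero_of_notMem_tsupport hz
    refine ⟨h1, ?_, ?_⟩
    · simp only [hwg, h2, map_zero]
    · simp only [hwΔ, h3, h4, mul_zero, add_zero]
  obtain ⟨CΔ, hCΔ⟩ := cwΔ.bounded_above_of_compact_support
    (hsuppφ.mono' fun z hz => by by_contra h; exact hz (hw0 z h).2.2)
  obtain ⟨Cφ, hCφ⟩ := cφ.bounded_above_of_compact_support hsuppφ
  obtain ⟨Cg, hCg⟩ := cwg.bounded_above_of_compact_support
    (hsuppφ.mono' fun z hz => by by_contra h; exact hz (hw0 z h).2.1)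
  have mwΔ : AEStronglyMeasurable wΔ volume := cwΔ.aestronglyMeasurable
  have mwφ : AEStronglyMeasurable wφ volume := cφ.aestronglyMeasurable
  have mwg : AEStronglyMeasurable wg volume := cwg.aestronglyMeasurable
  have bwΔ : ∀ᵐ z ∂(volume : Measure (ℝ × E)), ‖wΔ z‖ ≤ CΔ := Eventually.of_forall hCΔ
  have bwφ : ∀ᵐ z ∂(volume : Measure (ℝ × E)), ‖wφ z‖ ≤ Cφ := Eventually.of_forall hCφ
  have bwg : ∀ᵐ z ∂(volume : Measure (ℝ × E)), ‖wg z‖ ≤ Cg := Eventually.of_forall hCg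
  -- points of `S` where some weight is nonzero lie in `Kt`
  have hKt_of : ∀ z ∈ S, z ∈ tsupport (uncurry φ) → z ∈ Kt := fun z hz hz' =>
    ⟨hz', ⟨le_of_lt (show z.1 < t from hz.1.2), mem_univ _⟩⟩
  -- the bilinear forms
  set βI : E →L[ℝ] E →L[ℝ] ℝ := innerSL ℝ with hβI
  set βev : (E →L[ℝ] E) →L[ℝ] E →L[ℝ] E := ContinuousLinearMap.id ℝ (E →L[ℝ] E) with hβev
  set βb : Fin (finrank ℝ E) → (E →L[ℝ] E) →L[ℝ] E →L[ℝ] ℝ := fun i =>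
    (ContinuousLinearMap.compL ℝ E E ℝ (innerSL ℝ (b i))) with hβb
  set βF : Fin (finrank ℝ E) → (E →L[ℝ] E) →L[ℝ] (E →L[ℝ] E) →L[ℝ] ℝ := fun i =>
    (innerSL ℝ).bilinearComp (ContinuousLinearMap.apply ℝ E (b i))
      (ContinuousLinearMap.apply ℝ E (b i)) with hβF
  set βs : ℝ →L[ℝ] E →L[ℝ] E := ContinuousLinearMap.lsmul ℝ ℝ with hβs
  have βb_apply : ∀ i (L : E →L[ℝ] E) (x : E), βb i L x = ⟪b i, L x⟫ := fun i L x => by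
    simp [hβb]
  have βF_apply : ∀ i (L L' : E →L[ℝ] E), βF i L L' = ⟪L (b i), L' (b i)⟫ := fun i L L' => by
    simp [hβF]
  have βI_apply : ∀ x y : E, βI x y = ⟪x, y⟫ := fun x y => rfl
  have βs_apply : ∀ (a : ℝ) (x : E), βs a x = a • x := fun a x => rfl
  have βev_apply : ∀ (L : E →L[ℝ] E) (x : E), βev L x = L x := fun L x => rfl
  have wg_apply : ∀ (z : ℝ × E) (x : E), wg z x = ⟪gradient (φ z.1) z.2, x⟫ := fun z x => rfl
  -- the limits, term by term (as `n → ∞` through `ns`)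
  have cV2' : Tendsto (fun j => eLpNorm (uncurry (V (ns j)) - ũ) 2 volume) atTop (𝓝 0) :=
    cV2.comp hns.tendsto_atTop
  have cV3' : Tendsto (fun j => eLpNorm (uncurry (V (ns j)) - ũ) 3 volume) atTop (𝓝 0) :=
    cV3.comp hns.tendsto_atTop
  have cP' : Tendsto (fun j => eLpNorm (uncurry (Pm (ns j)) - pt) (3 / 2) volume) atTop (𝓝 0) :=
    cP.comp hns.tendsto_atTop
  have cG' : Tendsto (fun j => eLpNorm (uncurry (Gm (ns j)) - Gt) 2 volume) atTop (𝓝 0) :=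
    cG.comp hns.tendsto_atTop
  have cVQ4' : Tendsto (fun j => eLpNorm (uncurry (VQ (ns j)) - uQ) 4 volume) atTop (𝓝 0) :=
    cVQ4.comp hns.tendsto_atTop
  have cNQ' : ∀ i, Tendsto (fun j => eLpNorm (uncurry (NQm (ns j) i) - NQ i) 2 volume) atTop
      (𝓝 0) := fun i => (cNQ i).comp hns.tendsto_atTop
  -- T1
  have limT1 : Tendsto (fun j => ∫ z in S, wΔ z * βI (uncurry (V (ns j)) z) (uncurry (V (ns j)) z))
      atTop (𝓝 (∫ z in S, wΔ z * βI (ũ z) (ũ z))) :=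
    tendsto_setIntegral_mul_bilin (p := 2) (q := 2) one_le_two βI (fun j => mV2 (ns j)) hũ2
      (fun j => mV2 (ns j)) hũ2 cV2' cV2' mwΔ bwΔ S
  -- T2a
  have limT2a : ∀ i, Tendsto (fun j => ∫ z in S,
      wg z (innerSmulBilin (b i) (uncurry (V (ns j)) z) (uncurry (NQm (ns j) i) z))) atTop
      (𝓝 (∫ z in S, wg z (innerSmulBilin (b i) (ũ z) (NQ i z)))) := fun i =>
    tendsto_setIntegral_clm_bilin (p := 2) (q := 2) one_le_two (innerSmulBilin (b i))
      (fun j => mV2 (ns j)) hũ2 (fun j => mNQ (ns j) i) (hNQ2 i) cV2' (cNQ' i) mwg bwg S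
  -- T2b
  have limT2b : ∀ i, Tendsto (fun j => ∫ z in S,
      wφ z * βb i (uncurry (Gm (ns j)) z) (uncurry (NQm (ns j) i) z)) atTop
      (𝓝 (∫ z in S, wφ z * βb i (Gt z) (NQ i z))) := fun i =>
    tendsto_setIntegral_mul_bilin (p := 2) (q := 2) one_le_two (βb i)
      (fun j => mG (ns j)) hGt2 (fun j => mNQ (ns j) i) (hNQ2 i) cG' (cNQ' i) mwφ bwφ S
  -- LHS2
  have limL2 : ∀ i, Tendsto (fun j => ∫ z in S,
      wφ z * βF i (uncurry (Gm (ns j)) z) (uncurry (Gm (ns j)) z)) atTop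
      (𝓝 (∫ z in S, wφ z * βF i (Gt z) (Gt z))) := fun i =>
    tendsto_setIntegral_mul_bilin (p := 2) (q := 2) one_le_two (βF i)
      (fun j => mG (ns j)) hGt2 (fun j => mG (ns j)) hGt2 cG' cG' mwφ bwφ S
  -- T3
  have limT3 : Tendsto (fun j => ∫ z in S,
      wg z (βs (uncurry (Pm (ns j)) z) (uncurry (V (ns j)) z))) atTop
      (𝓝 (∫ z in S, wg z (βs (pt z) (ũ z)))) :=
    tendsto_setIntegral_clm_bilin (p := 3 / 2) (q := 3) (by norm_num) βs
      (fun j => mP (ns j)) hpt32 (fun j => mV3 (ns j)) hũ3 cP' cV3' mwg bwg S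
  -- DL (two stages)
  have mAm : ∀ j, MemLp (fun z => βev (uncurry (Gm (ns j)) z) (uncurry (VQ (ns j)) z)) (4 / 3)
      volume := fun j => memLp_bilin (p := 2) (q := 4) (r := 4 / 3) βev (mG (ns j)) (mVQ4 (ns j))
  have mA0 : MemLp (fun z => βev (Gt z) (uQ z)) (4 / 3) volume :=
    memLp_bilin (p := 2) (q := 4) (r := 4 / 3) βev hGt2 huQ4
  have one_le_43 : (1 : ℝ≥0∞) ≤ 4 / 3 := by
    have h : (1 : ℝ≥0∞) = 3 / 3 := (ENNReal.div_self (by norm_num) (by norm_num)).symm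
    rw [h]; gcongr; norm_num
  have cAm : Tendsto (fun j => eLpNorm ((fun z => βev (uncurry (Gm (ns j)) z) (uncurry (VQ (ns j)) z)) -
      fun z => βev (Gt z) (uQ z)) (4 / 3) volume) atTop (𝓝 0) := by
    have h := tendsto_eLpNorm_bilin_sub (p := 2) (q := 4) (r := 4 / 3) (by norm_num) one_le_43 βev
      (fun j => (mG (ns j)).1) hGt2.1 (fun j => (mVQ4 (ns j)).1) huQ4.1 hGt2.eLpNorm_lt_top
      huQ4.eLpNorm_lt_top cG' cVQ4'
    exact h
  have limDL : Tendsto (fun j => ∫ z in S, wφ z * βI (βev (uncurry (Gm (ns j)) z)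
      (uncurry (VQ (ns j)) z)) (uncurry (VQ (ns j)) z)) atTop
      (𝓝 (∫ z in S, wφ z * βI (βev (Gt z) (uQ z)) (uQ z))) :=
    tendsto_setIntegral_mul_bilin (p := 4 / 3) (q := 4) (by norm_num) βI mAm mA0
      (fun j => mVQ4 (ns j)) huQ4 cAm cVQ4' mwφ bwφ S
  -- DR (two stages)
  have msq : ∀ j, MemLp (fun z => βI (uncurry (V (ns j)) z) (uncurry (V (ns j)) z)) (3 / 2)
      volume := fun j => memLp_bilin (p := 3) (q := 3) (r := 3 / 2) βI (mV3 (ns j)) (mV3 (ns j))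
  have msq0 : MemLp (fun z => βI (ũ z) (ũ z)) (3 / 2) volume :=
    memLp_bilin (p := 3) (q := 3) (r := 3 / 2) βI hũ3 hũ3
  have csq : Tendsto (fun j => eLpNorm ((fun z => βI (uncurry (V (ns j)) z) (uncurry (V (ns j)) z)) -
      fun z => βI (ũ z) (ũ z)) (3 / 2) volume) atTop (𝓝 0) :=
    tendsto_eLpNorm_bilin_sub (p := 3) (q := 3) (r := 3 / 2) (by norm_num) one_le_three_halves βI
      (fun j => (mV3 (ns j)).1) hũ3.1 (fun j => (mV3 (ns j)).1) hũ3.1 hũ3.eLpNorm_lt_top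
      hũ3.eLpNorm_lt_top cV3' cV3'
  have limDR : Tendsto (fun j => ∫ z in S, wg z (βs (βI (uncurry (V (ns j)) z)
      (uncurry (V (ns j)) z)) (uncurry (V (ns j)) z))) atTop
      (𝓝 (∫ z in S, wg z (βs (βI (ũ z) (ũ z)) (ũ z)))) :=
    tendsto_setIntegral_clm_bilin (p := 3 / 2) (q := 3) (by norm_num) βs msq msq0
      (fun j => mV3 (ns j)) hũ3 csq cV3' mwg bwg S
  -- L1 (the slice at time `t`)
  have limL1 : Tendsto (fun j => ∫ y in (univ : Set E), φ t y * βI (V (ns j) t y) (V (ns j) t y))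
      atTop (𝓝 (∫ y in (univ : Set E), φ t y * βI (ũ (t, y)) (ũ (t, y)))) := by
    have mVt : ∀ j, MemLp (fun y => V (ns j) t y) 2 volume := fun j =>
      ((hVc (ns j)).comp (Continuous.prodMk_right t)).memLp_of_hasCompactSupport
        (hasCompactSupport_slice_of_uncurry (hVcs (ns j)) t)
    have mũt : MemLp (fun y => ũ (t, y)) 2 volume := by
      refine ⟨htm, ?_⟩
      rw [eLpNorm_two_eq_rpow]
      exact ENNReal.rpow_lt_top_of_nonneg (by norm_num) htf.ne
    have hconv : Tendsto (fun j => eLpNorm ((fun y => V (ns j) t y) - fun y => ũ (t, y)) 2 volume)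
        atTop (𝓝 0) := hts
    exact tendsto_setIntegral_mul_bilin (p := 2) (q := 2) one_le_two βI mVt mũt mVt mũt hconv hconv
      (cφ.comp (Continuous.prodMk_right t)).aestronglyMeasurable
      (Eventually.of_forall fun y => hCφ (t, y)) univ
  -- ### (d2) the identities in `T`-form for large `j`
  have hDVKt : ∀ n, (bump n).rOut ≤ ε / 2 → ∀ z ∈ Kt, fderiv ℝ (V n z.1) z.2 = Gm n z.1 z.2 :=
    fun n hn z hz => hG.fderiv_mollified hvI' hGI' (hkinf n) (hkr n)
      ((hballKt _ hz _ hn).trans hQ'Qo)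
  -- pointwise rewriting of the integrands on `S`
  have pwL2 : ∀ n, (bump n).rOut ≤ ε / 2 → ∀ z ∈ S,
      φ z.1 z.2 * frobeniusNormSq (fderiv ℝ (V n z.1) z.2) =
        ∑ i, wφ z * βF i (uncurry (Gm n) z) (uncurry (Gm n) z) := by
    intro n hn z hz
    by_cases hzs : z ∈ tsupport (uncurry φ)
    · rw [hDVKt n hn z (hKt_of z hz hzs), frobeniusNormSq_eq_sum b, Finset.mul_sum]
      refine Finset.sum_congr rfl fun i _ => ?_
      rw [βF_apply, real_inner_self_eq_norm_sq]; rfl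
    · have h0 := (hw0 z hzs).1
      simp only [hwφ] at h0 ⊢
      simp [h0]
  have pwR : ∀ n, (bump n).rOut ≤ ε / 2 → ∀ z ∈ S,
      (‖V n z.1 z.2‖ ^ 2 * ((1 : ℝ) * (Δ (φ z.1)) z.2 + timeDeriv φ z.1 z.2) +
        2 * (∑ i, (⟪N n i z.1 z.2, gradient (φ z.1) z.2⟫ * ⟪V n z.1 z.2, b i⟫ +
          φ z.1 z.2 * ⟪fderiv ℝ (V n z.1) z.2 (N n i z.1 z.2), b i⟫)) +
        2 * (Pm n z.1 z.2 * ⟪V n z.1 z.2, gradient (φ z.1) z.2⟫)) =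
      wΔ z * βI (uncurry (V n) z) (uncurry (V n) z) +
        2 * (∑ i, (wg z (innerSmulBilin (b i) (uncurry (V n) z) (uncurry (NQm n i) z)) +
          wφ z * βb i (uncurry (Gm n) z) (uncurry (NQm n i) z))) +
        2 * wg z (βs (uncurry (Pm n) z) (uncurry (V n) z)) := by
    intro n hn z hz
    have e1 : ‖V n z.1 z.2‖ ^ 2 * ((1 : ℝ) * (Δ (φ z.1)) z.2 + timeDeriv φ z.1 z.2) =
        wΔ z * βI (uncurry (V n) z) (uncurry (V n) z) := by
      rw [βI_apply, real_inner_self_eq_norm_sq, mul_comm]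
      simp only [hwΔ, uncurry]
    have e3 : Pm n z.1 z.2 * ⟪V n z.1 z.2, gradient (φ z.1) z.2⟫ =
        wg z (βs (uncurry (Pm n) z) (uncurry (V n) z)) := by
      rw [wg_apply, βs_apply, real_inner_smul_right, real_inner_comm]
      simp only [uncurry]
    have e2 : (∑ i, (⟪N n i z.1 z.2, gradient (φ z.1) z.2⟫ * ⟪V n z.1 z.2, b i⟫ +
          φ z.1 z.2 * ⟪fderiv ℝ (V n z.1) z.2 (N n i z.1 z.2), b i⟫)) =
        ∑ i, (wg z (innerSmulBilin (b i) (uncurry (V n) z) (uncurry (NQm n i) z)) +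
          wφ z * βb i (uncurry (Gm n) z) (uncurry (NQm n i) z)) := by
      by_cases hzs : z ∈ tsupport (uncurry φ)
      · have hzK := hKt_of z hz hzs
        obtain ⟨-, hNloc⟩ := hloc n hn z hzK
        refine Finset.sum_congr rfl fun i _ => ?_
        rw [hNloc i, hDVKt n hn z hzK, wg_apply, innerSmulBilin_apply, real_inner_smul_right,
          βb_apply]
        simp only [hwφ, uncurry]
        rw [real_inner_comm (NQm n i z.1 z.2) (gradient (φ z.1) z.2),
          real_inner_comm (Gm n z.1 z.2 (NQm n i z.1 z.2)) (b i)]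
        ring
      · obtain ⟨h0, hg0', -⟩ := hw0 z hzs
        have hg' : gradient (φ z.1) z.2 = 0 := (weights_eq_zero_of_notMem_tsupport hzs).2.1
        refine Finset.sum_congr rfl fun i _ => ?_
        simp only [hwφ] at h0
        simp only [hg', h0, hg0', inner_zero_right, zero_mul, _root_.zero_apply, hwφ, zero_add]
    rw [e1, e2, e3]
  have pwDL : ∀ n, (bump n).rOut ≤ ε / 2 → ∀ z ∈ S,
      φ z.1 z.2 * ⟪Gm n z.1 z.2 (V n z.1 z.2), V n z.1 z.2⟫ =
        wφ z * βI (βev (uncurry (Gm n) z) (uncurry (VQ n) z)) (uncurry (VQ n) z) := by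
    intro n hn z hz
    by_cases hzs : z ∈ tsupport (uncurry φ)
    · obtain ⟨hVloc, -⟩ := hloc n hn z (hKt_of z hz hzs)
      rw [hVloc]; rfl
    · have h0 := (hw0 z hzs).1
      simp only [hwφ] at h0 ⊢
      simp [h0]
  have pwDR : ∀ n (z : ℝ × E), ‖V n z.1 z.2‖ ^ 2 * ⟪V n z.1 z.2, gradient (φ z.1) z.2⟫ =
      wg z (βs (βI (uncurry (V n) z) (uncurry (V n) z)) (uncurry (V n) z)) := by
    intro n z
    rw [wg_apply, βs_apply, βI_apply, real_inner_smul_right, real_inner_self_eq_norm_sq,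
      real_inner_comm]
    simp only [uncurry]
  have pwL1 : ∀ n (y : E), φ t y * ‖V n t y‖ ^ 2 = φ t y * βI (V n t y) (V n t y) := fun n y => by
    rw [βI_apply, real_inner_self_eq_norm_sq]
  -- integrability of the pieces (globally, hence on `S`)
  have iT2a : ∀ n i, Integrable (fun z => wg z (innerSmulBilin (b i) (uncurry (V n) z)
      (uncurry (NQm n i) z))) (volume : Measure (ℝ × E)) := fun n i =>
    integrable_clm_bilin_of_memLp (p := 2) (q := 2) _ (mV2 n) (mNQ n i) mwg bwg
  have iT2b : ∀ n i, Integrable (fun z => wφ z * βb i (uncurry (Gm n) z) (uncurry (NQm n i) z))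
      (volume : Measure (ℝ × E)) := fun n i =>
    integrable_mul_bilin_of_memLp (p := 2) (q := 2) _ (mG n) (mNQ n i) mwφ bwφ
  have iT1 : ∀ n, Integrable (fun z => wΔ z * βI (uncurry (V n) z) (uncurry (V n) z))
      (volume : Measure (ℝ × E)) := fun n =>
    integrable_mul_bilin_of_memLp (p := 2) (q := 2) _ (mV2 n) (mV2 n) mwΔ bwΔ
  have iT3 : ∀ n, Integrable (fun z => wg z (βs (uncurry (Pm n) z) (uncurry (V n) z)))
      (volume : Measure (ℝ × E)) := fun n =>
    integrable_clm_bilin_of_memLp (p := 3 / 2) (q := 3) _ (mP n) (mV3 n) mwg bwg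
  have iL2 : ∀ n i, Integrable (fun z => wφ z * βF i (uncurry (Gm n) z) (uncurry (Gm n) z))
      (volume : Measure (ℝ × E)) := fun n i =>
    integrable_mul_bilin_of_memLp (p := 2) (q := 2) _ (mG n) (mG n) mwφ bwφ
  -- the identities in `T`-form
  have hIDT : ∀ j, (bump (ns j)).rOut ≤ ε / 2 →
      (∫ y in (univ : Set E), φ t y * βI (V (ns j) t y) (V (ns j) t y)) +
        2 * (1 : ℝ) * ∑ i, ∫ z in S, wφ z * βF i (uncurry (Gm (ns j)) z) (uncurry (Gm (ns j)) z) =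
      (∫ z in S, wΔ z * βI (uncurry (V (ns j)) z) (uncurry (V (ns j)) z)) +
        2 * ((∑ i, ∫ z in S, wg z (innerSmulBilin (b i) (uncurry (V (ns j)) z)
          (uncurry (NQm (ns j) i) z))) +
          ∑ i, ∫ z in S, wφ z * βb i (uncurry (Gm (ns j)) z) (uncurry (NQm (ns j) i) z)) +
        2 * ∫ z in S, wg z (βs (uncurry (Pm (ns j)) z) (uncurry (V (ns j)) z)) := by
    intro j hj
    set n := ns j with hn_def
    have h := hID n hj
    -- left-hand side
    have eL1 : ∫ y, φ t y * ‖V n t y‖ ^ 2 = ∫ y in (univ : Set E), φ t y * βI (V n t y) (V n t y) := by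
      rw [Measure.restrict_univ]
      exact integral_congr_ae (Eventually.of_forall (pwL1 n))
    have eL2 : ∫ z in S, φ z.1 z.2 * frobeniusNormSq (fderiv ℝ (V n z.1) z.2) =
        ∑ i, ∫ z in S, wφ z * βF i (uncurry (Gm n) z) (uncurry (Gm n) z) := by
      rw [setIntegral_congr_fun (measurableSet_Ioo.prod MeasurableSet.univ) (pwL2 n hj),
        integral_finsetSum _ fun i _ => (iL2 n i).integrableOn]
    have eR : ∫ z in S, (‖V n z.1 z.2‖ ^ 2 * ((1 : ℝ) * (Δ (φ z.1)) z.2 + timeDeriv φ z.1 z.2) +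
        2 * (∑ i, (⟪N n i z.1 z.2, gradient (φ z.1) z.2⟫ * ⟪V n z.1 z.2, b i⟫ +
          φ z.1 z.2 * ⟪fderiv ℝ (V n z.1) z.2 (N n i z.1 z.2), b i⟫)) +
        2 * (Pm n z.1 z.2 * ⟪V n z.1 z.2, gradient (φ z.1) z.2⟫)) =
        (∫ z in S, wΔ z * βI (uncurry (V n) z) (uncurry (V n) z)) +
        2 * ((∑ i, ∫ z in S, wg z (innerSmulBilin (b i) (uncurry (V n) z) (uncurry (NQm n i) z))) +
          ∑ i, ∫ z in S, wφ z * βb i (uncurry (Gm n) z) (uncurry (NQm n i) z)) +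
        2 * ∫ z in S, wg z (βs (uncurry (Pm n) z) (uncurry (V n) z)) := by
      rw [setIntegral_congr_fun (measurableSet_Ioo.prod MeasurableSet.univ) (pwR n hj)]
      have iS : Integrable (fun z => ∑ i, (wg z (innerSmulBilin (b i) (uncurry (V n) z)
          (uncurry (NQm n i) z)) + wφ z * βb i (uncurry (Gm n) z) (uncurry (NQm n i) z)))
          (volume.restrict S) :=
        integrable_finsetSum _ fun i _ => ((iT2a n i).add (iT2b n i)).integrableOn
      have i1 : Integrable (fun z => wΔ z * βI (uncurry (V n) z) (uncurry (V n) z))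
          (volume.restrict S) := (iT1 n).integrableOn
      have i2 : Integrable (fun z => 2 * ∑ i, (wg z (innerSmulBilin (b i) (uncurry (V n) z)
          (uncurry (NQm n i) z)) + wφ z * βb i (uncurry (Gm n) z) (uncurry (NQm n i) z)))
          (volume.restrict S) := iS.const_mul 2
      have i3 : Integrable (fun z => 2 * wg z (βs (uncurry (Pm n) z) (uncurry (V n) z)))
          (volume.restrict S) := (iT3 n).integrableOn.const_mul 2
      have i12 : Integrable (fun z => wΔ z * βI (uncurry (V n) z) (uncurry (V n) z) +
          2 * ∑ i, (wg z (innerSmulBilin (b i) (uncurry (V n) z)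
          (uncurry (NQm n i) z)) + wφ z * βb i (uncurry (Gm n) z) (uncurry (NQm n i) z)))
          (volume.restrict S) := i1.add i2
      have iTi : ∀ i ∈ Finset.univ, Integrable (fun z => wg z (innerSmulBilin (b i) (uncurry (V n) z)
          (uncurry (NQm n i) z)) + wφ z * βb i (uncurry (Gm n) z) (uncurry (NQm n i) z))
          (volume.restrict S) := fun i _ => ((iT2a n i).add (iT2b n i)).integrableOn
      rw [integral_add i12 i3, integral_add i1 i2, integral_const_mul, integral_const_mul,
        integral_finsetSum _ iTi]
      congr 2
      congr 1
      rw [← Finset.sum_add_distrib]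
      refine Finset.sum_congr rfl fun i _ => ?_
      exact integral_add (iT2a n i).integrableOn (iT2b n i).integrableOn
    rw [← eL1, ← eL2, ← eR]
    exact h
  have hDAGT : ∀ j, (bump (ns j)).rOut ≤ ε / 2 →
      2 * ∫ z in S, wφ z * βI (βev (uncurry (Gm (ns j)) z) (uncurry (VQ (ns j)) z))
          (uncurry (VQ (ns j)) z) =
      -∫ z in S, wg z (βs (βI (uncurry (V (ns j)) z) (uncurry (V (ns j)) z))
          (uncurry (V (ns j)) z)) := by
    intro j hj
    have h := hDAG (ns j) hj
    rw [setIntegral_congr_fun (measurableSet_Ioo.prod MeasurableSet.univ) (pwDL (ns j) hj),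
      integral_congr_ae (Eventually.of_forall (pwDR (ns j)))] at h
    exact h
  -- ### the limit identities
  have hev : ∀ᶠ j in atTop, (bump (ns j)).rOut ≤ ε / 2 :=
    ((tendsto_order.1 hbrs).2 (ε / 2) (by linarith)).mono fun j hj => hj.le
  have I1 : (∫ y in (univ : Set E), φ t y * βI (ũ (t, y)) (ũ (t, y))) +
      2 * (1 : ℝ) * ∑ i, ∫ z in S, wφ z * βF i (Gt z) (Gt z) =
      (∫ z in S, wΔ z * βI (ũ z) (ũ z)) +
      2 * ((∑ i, ∫ z in S, wg z (innerSmulBilin (b i) (ũ z) (NQ i z))) +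
        ∑ i, ∫ z in S, wφ z * βb i (Gt z) (NQ i z)) +
      2 * ∫ z in S, wg z (βs (pt z) (ũ z)) := by
    refine tendsto_nhds_unique_of_eventuallyEq
      (limL1.add ((tendsto_finsetSum _ fun i _ => limL2 i).const_mul _))
      ((limT1.add (((tendsto_finsetSum _ fun i _ => limT2a i).add
        (tendsto_finsetSum _ fun i _ => limT2b i)).const_mul _)).add (limT3.const_mul _))
      (hev.mono fun j hj => hIDT j hj)
  have I2 : 2 * ∫ z in S, wφ z * βI (βev (Gt z) (uQ z)) (uQ z) =
      -∫ z in S, wg z (βs (βI (ũ z) (ũ z)) (ũ z)) :=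
    tendsto_nhds_unique_of_eventuallyEq (limDL.const_mul _) limDR.neg
      (hev.mono fun j hj => hDAGT j hj)
  -- ### (e) identification of the limits
  set Sω : Set (ℝ × E) := Ioo (-1 : ℝ) t ×ˢ (ω : Set E) with hSω_def
  have hSm : MeasurableSet S := measurableSet_Ioo.prod MeasurableSet.univ
  have hSωm : MeasurableSet Sω := measurableSet_Ioo.prod ω.isOpen.measurableSet
  have hSωS : Sω ⊆ S := prod_mono Subset.rfl (subset_univ _)
  have hSωQ : Sω ⊆ Ioo (-1 : ℝ) 0 ×ˢ ball (0 : E) 1 := by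
    rw [hSω_def, hω]; exact prod_mono (Ioo_subset_Ioo le_rfl ht.2.le) Subset.rfl
  have honQ : ∀ z ∈ Sω, z ∈ (Qo : Set (ℝ × E)) := fun z hz => by rw [hQ]; exact hSωQ hz
  have hoff : ∀ z ∈ S \ Sω, z ∉ tsupport (uncurry φ) := by
    rintro z ⟨hzS, hzω⟩ hzs
    have hz : z ∈ (forwardCylinder ω (-1) : Set (ℝ × E)) := hφ.tsupport_subset hzs
    rw [coe_forwardCylinder] at hz
    exact hzω ⟨hzS.1, hz.2⟩
  have hũv : ∀ z ∈ Sω, ũ z = v z.1 z.2 := fun z hz => zeroExt_of_mem _ (honQ z hz)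
  have hptp : ∀ z ∈ Sω, pt z = p z.1 z.2 := fun z hz => zeroExt_of_mem _ (honQ z hz)
  have hGtG : ∀ z ∈ Sω, Gt z = G z.1 z.2 := fun z hz => zeroExt_of_mem _ (honQ z hz)
  have huQũ : ∀ z ∈ S, z ∈ tsupport (uncurry φ) → uQ z = ũ z := fun z hz hzs => by
    rw [huQ, indicator_of_mem (hKtQ' (hKt_of z hz hzs))]
  -- restriction from `S` to `Sω` for integrands carrying a weight
  have hrestr : ∀ {f : ℝ × E → ℝ}, (∀ z, z ∉ tsupport (uncurry φ) → f z = 0) →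
      ∫ z in S, f z = ∫ z in Sω, f z := fun {f} hf =>
    setIntegral_eq_of_subset_of_forall_sdiff_eq_zero hSm hSωS fun z hz => hf z (hoff z hz)
  -- cL1
  have cL1 : ∫ y in (univ : Set E), φ t y * βI (ũ (t, y)) (ũ (t, y)) =
      ∫ x in (ω : Set E), φ t x * ‖v t x‖ ^ 2 := by
    rw [setIntegral_eq_of_subset_of_forall_sdiff_eq_zero MeasurableSet.univ (subset_univ (ω : Set E))]
    · refine setIntegral_congr_fun ω.isOpen.measurableSet fun y hy => ?_
      have hty : ((t, y) : ℝ × E) ∈ (Qo : Set (ℝ × E)) := by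
        rw [hQ]; refine ⟨ht, ?_⟩; rw [hω] at hy; exact hy
      have : ũ (t, y) = v t y := zeroExt_of_mem _ hty
      rw [βI_apply, real_inner_self_eq_norm_sq, this]
    · rintro y ⟨-, hy⟩
      have : φ t y = 0 := by
        by_contra h
        rw [hω] at hy
        exact hy (hω' h).2
      rw [this, zero_mul]
  -- cL2
  have iL2inf : ∀ i, Integrable (fun z => wφ z * βF i (Gt z) (Gt z)) (volume : Measure (ℝ × E)) :=
    fun i => integrable_mul_bilin_of_memLp (p := 2) (q := 2) _ hGt2 hGt2 mwφ bwφ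
  have cL2 : ∑ i, ∫ z in S, wφ z * βF i (Gt z) (Gt z) =
      ∫ z in Sω, φ z.1 z.2 * frobeniusNormSq (G z.1 z.2) := by
    rw [← integral_finsetSum _ fun i _ => (iL2inf i).integrableOn]
    rw [hrestr (fun z hz => by
      simp only [hwφ] at *; simp [(hw0 z hz).1] )]
    refine setIntegral_congr_fun hSωm fun z hz => ?_
    rw [hGtG z hz, frobeniusNormSq_eq_sum b, Finset.mul_sum]
    refine Finset.sum_congr rfl fun i _ => ?_
    rw [βF_apply, real_inner_self_eq_norm_sq]
  -- cT1
  have cT1 : ∫ z in S, wΔ z * βI (ũ z) (ũ z) =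
      ∫ z in Sω, ‖v z.1 z.2‖ ^ 2 * ((1 : ℝ) * (Δ (φ z.1)) z.2 + timeDeriv φ z.1 z.2) := by
    rw [hrestr (fun z hz => by rw [(hw0 z hz).2.2, zero_mul])]
    refine setIntegral_congr_fun hSωm fun z hz => ?_
    rw [βI_apply, real_inner_self_eq_norm_sq, hũv z hz, mul_comm]
  -- cDR
  have cDR : ∫ z in S, wg z (βs (βI (ũ z) (ũ z)) (ũ z)) =
      ∫ z in Sω, ‖v z.1 z.2‖ ^ 2 * ⟪v z.1 z.2, gradient (φ z.1) z.2⟫ := by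
    rw [hrestr (fun z hz => by rw [(hw0 z hz).2.1, _root_.zero_apply])]
    refine setIntegral_congr_fun hSωm fun z hz => ?_
    rw [wg_apply, βs_apply, βI_apply, real_inner_smul_right, real_inner_self_eq_norm_sq, hũv z hz,
      real_inner_comm]
  -- cT3
  have cT3 : ∫ z in S, wg z (βs (pt z) (ũ z)) =
      ∫ z in Sω, p z.1 z.2 * ⟪v z.1 z.2, gradient (φ z.1) z.2⟫ := by
    rw [hrestr (fun z hz => by rw [(hw0 z hz).2.1, _root_.zero_apply])]
    refine setIntegral_congr_fun hSωm fun z hz => ?_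
    rw [wg_apply, βs_apply, real_inner_smul_right, hũv z hz, hptp z hz, real_inner_comm]
  -- I3: `Σᵢ T2b∞(i) = DL∞`
  have iT2binf : ∀ i, Integrable (fun z => wφ z * βb i (Gt z) (NQ i z)) (volume : Measure (ℝ × E)) :=
    fun i => integrable_mul_bilin_of_memLp (p := 2) (q := 2) _ hGt2 (hNQ2 i) mwφ bwφ
  have I3 : ∑ i, ∫ z in S, wφ z * βb i (Gt z) (NQ i z) =
      ∫ z in S, wφ z * βI (βev (Gt z) (uQ z)) (uQ z) := by
    rw [← integral_finsetSum _ fun i _ => (iT2binf i).integrableOn]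
    refine integral_congr_ae (Eventually.of_forall fun z => ?_)
    show (∑ i, wφ z * βb i (Gt z) (NQ i z)) = wφ z * βI (βev (Gt z) (uQ z)) (uQ z)
    rw [← Finset.mul_sum]
    congr 1
    rw [βI_apply, βev_apply]
    have e : ∀ i, βb i (Gt z) (NQ i z) = ⟪uQ z, b i⟫ * ⟪b i, Gt z (uQ z)⟫ := fun i => by
      rw [βb_apply]
      change ⟪b i, Gt z (⟪uQ z, b i⟫ • uQ z)⟫ = _
      rw [map_smul, real_inner_smul_right]
    simp_rw [e]
    rw [b.sum_inner_mul_inner, real_inner_comm]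
  -- I4: `Σᵢ T2a∞(i) = DR∞`
  have iT2ainf : ∀ i, Integrable (fun z => wg z (innerSmulBilin (b i) (ũ z) (NQ i z)))
      (volume : Measure (ℝ × E)) := fun i =>
    integrable_clm_bilin_of_memLp (p := 2) (q := 2) _ hũ2 (hNQ2 i) mwg bwg
  have I4 : ∑ i, ∫ z in S, wg z (innerSmulBilin (b i) (ũ z) (NQ i z)) =
      ∫ z in S, wg z (βs (βI (ũ z) (ũ z)) (ũ z)) := by
    rw [← integral_finsetSum _ fun i _ => (iT2ainf i).integrableOn]
    refine setIntegral_congr_fun hSm fun z hz => ?_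
    show (∑ i, wg z (innerSmulBilin (b i) (ũ z) (NQ i z))) = wg z (βs (βI (ũ z) (ũ z)) (ũ z))
    by_cases hzs : z ∈ tsupport (uncurry φ)
    · have hu : uQ z = ũ z := huQũ z hz hzs
      have e : ∀ i, innerSmulBilin (b i) (ũ z) (NQ i z) = (⟪ũ z, b i⟫ ^ 2) • ũ z :=
        fun i => by
        rw [innerSmulBilin_apply]
        change ⟪ũ z, b i⟫ • (⟪uQ z, b i⟫ • uQ z) = _
        rw [hu, smul_smul, sq]
      have e2 : βs (βI (ũ z) (ũ z)) (ũ z) = (∑ i, ⟪ũ z, b i⟫ ^ 2) • ũ z := by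
        rw [βs_apply, βI_apply, real_inner_self_eq_norm_sq, b.sum_sq_inner_left]
      simp_rw [e]
      rw [← map_sum, ← Finset.sum_smul, e2]
    · rw [(hw0 z hzs).2.1]
      simp
  -- integrability of the target integrands on `Sω`
  have iA : IntegrableOn (fun z : ℝ × E => ‖v z.1 z.2‖ ^ 2 * ((1 : ℝ) * (Δ (φ z.1)) z.2 +
      timeDeriv φ z.1 z.2)) Sω volume := by
    refine ((integrable_mul_bilin_of_memLp (p := 2) (q := 2) βI hũ2 hũ2 mwΔ bwΔ).integrableOn).congr_fun
      (fun z hz => ?_) hSωm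
    show wΔ z * βI (ũ z) (ũ z) = _
    rw [βI_apply, real_inner_self_eq_norm_sq, hũv z hz, mul_comm]
  have iB1 : IntegrableOn (fun z : ℝ × E => ‖v z.1 z.2‖ ^ 2 * ⟪v z.1 z.2, gradient (φ z.1) z.2⟫)
      Sω volume := by
    refine ((integrable_clm_bilin_of_memLp (p := 3 / 2) (q := 3) βs msq0 hũ3 mwg bwg).integrableOn).congr_fun
      (fun z hz => ?_) hSωm
    show wg z (βs (βI (ũ z) (ũ z)) (ũ z)) = _
    rw [wg_apply, βs_apply, βI_apply, real_inner_smul_right, real_inner_self_eq_norm_sq, hũv z hz,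
      real_inner_comm]
  have iB2 : IntegrableOn (fun z : ℝ × E => p z.1 z.2 * ⟪v z.1 z.2, gradient (φ z.1) z.2⟫)
      Sω volume := by
    refine ((integrable_clm_bilin_of_memLp (p := 3 / 2) (q := 3) βs hpt32 hũ3 mwg bwg).integrableOn).congr_fun
      (fun z hz => ?_) hSωm
    show wg z (βs (pt z) (ũ z)) = _
    rw [wg_apply, βs_apply, real_inner_smul_right, hũv z hz, hptp z hz, real_inner_comm]
  -- the target right-hand side, split
  have hRHS : ∫ z in Sω, (‖v z.1 z.2‖ ^ 2 * ((1 : ℝ) * (Δ (φ z.1)) z.2 + timeDeriv φ z.1 z.2) +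
      ⟪v z.1 z.2, gradient (φ z.1) z.2⟫ * (‖v z.1 z.2‖ ^ 2 + 2 * p z.1 z.2)) =
      (∫ z in Sω, ‖v z.1 z.2‖ ^ 2 * ((1 : ℝ) * (Δ (φ z.1)) z.2 + timeDeriv φ z.1 z.2)) +
      ((∫ z in Sω, ‖v z.1 z.2‖ ^ 2 * ⟪v z.1 z.2, gradient (φ z.1) z.2⟫) +
        2 * ∫ z in Sω, p z.1 z.2 * ⟪v z.1 z.2, gradient (φ z.1) z.2⟫) := by
    have e : ∀ z : ℝ × E, ⟪v z.1 z.2, gradient (φ z.1) z.2⟫ * (‖v z.1 z.2‖ ^ 2 + 2 * p z.1 z.2) =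
        ‖v z.1 z.2‖ ^ 2 * ⟪v z.1 z.2, gradient (φ z.1) z.2⟫ +
          2 * (p z.1 z.2 * ⟪v z.1 z.2, gradient (φ z.1) z.2⟫) := fun z => by ring
    simp_rw [e]
    have iB2' : Integrable (fun z : ℝ × E => 2 * (p z.1 z.2 * ⟪v z.1 z.2, gradient (φ z.1) z.2⟫))
        (volume.restrict Sω) := iB2.const_mul 2
    have iB12 : Integrable (fun z : ℝ × E => ‖v z.1 z.2‖ ^ 2 * ⟪v z.1 z.2, gradient (φ z.1) z.2⟫ +
        2 * (p z.1 z.2 * ⟪v z.1 z.2, gradient (φ z.1) z.2⟫)) (volume.restrict Sω) := iB1.add iB2'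
    rw [integral_add iA iB12, integral_add iB1 iB2', integral_const_mul]
  -- conclusion
  linarith [cL1, cL2, hRHS, cT1, cDR, cT3, I1, I2, I3, I4]

end Main

end Literature.Analysis.FluidPDE

/-! ### The named fact `NS.ess_suitable_of_L3infty'` -/

namespace Literature.Analysis.FluidPDE

/-- The unit time cylinder over the unit ball is the unit backward parabolic cylinder (as open
sets of space–time). [folklore] -/
theorem timeCylinder_unitBall_eq :
    FluidPDE.timeCylinder unitBall (-1) 0 =
      FluidPDE.parabolicCylinderOpens 1 ((0 : ℝ), (0 : EuclideanSpace ℝ (Fin 3))) := by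
  ext z
  change z ∈ Ioo (-1 : ℝ) 0 ×ˢ ball (0 : EuclideanSpace ℝ (Fin 3)) 1 ↔
    z ∈ FluidPDE.parabolicCylinder 1 ((0 : ℝ), (0 : EuclideanSpace ℝ (Fin 3)))
  rw [FluidPDE.parabolicCylinder_one_zero]

/-- **Discharge of `NS.ess_suitable_of_L3infty'`** (Escauriaza–Seregin–Šverák 2003, proof of
Thm. 1.4, first paragraph): pairs `(v, p)` on the unit cylinder `Q = (-1, 0) × B(0, 1)` of `ℝ³`
solving the Navier–Stokes system (`ν = 1`, no force) in the sense of distributions with (1.15)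
`v ∈ L_{2,∞}(Q)`, `∇v ∈ L₂(Q)` (weak spatial gradient), `p ∈ L_{3/2}(Q)` and (1.16)
`v ∈ L_{3,∞}(Q)` are suitable weak solutions in the sense of ESS Def. 2.1 (corrected rendering
`Fluid.IsESSSuitablePairOn`): (2.1)–(2.3) are among the hypotheses and (2.4) is
`Fluid.ae_localEnergyInequality_of_L3infty` ("usual mollification and the fact `v ∈ L₄(Q)`").
Real proof. [cite: EscauriazaSereginSverak2003, §3, proof of Thm. 1.4, first paragraph] -/
theorem ess_suitable_of_L3infty'_holds : ess_suitable_of_L3infty' := by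
  intro v p hNS h2 hG hp h3
  have hE : finrank ℝ (EuclideanSpace ℝ (Fin 3)) = 3 := finrank_euclideanSpace_fin_three
  have hω : ((unitBall : Opens (EuclideanSpace ℝ (Fin 3))) : Set (EuclideanSpace ℝ (Fin 3))) =
      ball (0 : EuclideanSpace ℝ (Fin 3)) 1 := rfl
  have hQ' : FluidPDE.parabolicCylinder 1 ((0 : ℝ), (0 : EuclideanSpace ℝ (Fin 3))) =
      Ioo (-1 : ℝ) 0 ×ˢ ball (0 : EuclideanSpace ℝ (Fin 3)) 1 := FluidPDE.parabolicCylinder_one_zero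
  obtain ⟨G, hGw, hG2⟩ := hG
  refine ⟨h2, ?_, ?_, ⟨G, ?_, ?_, ?_⟩⟩
  · rw [hQ'] at hp; exact hp
  · rw [timeCylinder_unitBall_eq]; exact hNS
  · rw [timeCylinder_unitBall_eq]; exact hGw
  · rw [hQ'] at hG2; exact hG2
  · exact FluidPDE.ae_localEnergyInequality_of_L3infty hE hω hNS h2 hGw hG2 hp h3

end Literature.Analysis.FluidPDE

/-! ### The mis-parenthesised predicate implies the corrected one on domains of volume `≥ 1` -/

namespace Literature.Analysis.FluidPDE

section Comparison

variable {E : Type*} [NormedAddCommGroup E] [InnerProductSpace ℝ E] [FiniteDimensional ℝ E]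
  [MeasurableSpace E] [BorelSpace E]
variable {ω : Opens E} {a b ν : ℝ} {u : ℝ → E → E} {p : ℝ → E → ℝ}

/-- For an `IsSuitablePairOn` pair, a.e. time slice `x ↦ |u(t, x)|²` is integrable on `ω`:
measurability of the slices from the local integrability of `u` on the cylinder ((2.3), first
conjunct, and Fubini), finiteness from the energy class (2.1). [cite: EscauriazaSereginSverak2003, Def. 2.1 (2.1)] -/
theorem IsSuitablePairOn.ae_integrable_norm_sq (h : IsSuitablePairOn ω a b ν u p) :
    ∀ᵐ t ∂(volume.restrict (Ioo a b)),
      Integrable (fun x => ‖u t x‖ ^ 2) (volume.restrict (ω : Set E)) := by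
  have hmeas : AEStronglyMeasurable (uncurry u)
      ((volume.restrict (Ioo a b)).prod (volume.restrict (ω : Set E))) := by
    rw [Measure.prod_restrict, ← Measure.volume_eq_prod]
    exact h.distributional.1.aestronglyMeasurable
  obtain ⟨C, hC⟩ := h.energyClass
  filter_upwards [hmeas.prodMk_left, hC] with t ht htC
  refine ⟨(ht.norm.pow 2), ?_⟩
  show ∫⁻ x in (ω : Set E), ‖‖u t x‖ ^ 2‖ₑ < ∞
  have e : ∀ x, ‖‖u t x‖ ^ 2‖ₑ = ‖u t x‖ₑ ^ 2 := fun x => by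
    rw [Real.enorm_eq_ofReal (sq_nonneg _), ENNReal.ofReal_pow (norm_nonneg _),
      ofReal_norm]
  simp_rw [e]
  exact htC.trans_lt ENNReal.coe_lt_top

/-- **The mis-parenthesised (2.4) implies the printed (2.4) when `1 ≤ |ω| < ∞` and `0 ≤ ν`.**
In `IsSuitablePairOn.localEnergy` the left-hand side is `∫_ω (φ|u|²(t) + 2ν ∫∫ φ|∇u|²) dx
= ∫_ω φ|u|²(t) dx + |ω| · 2ν ∫∫ φ|∇u|²` (the slice `φ(t)|u(t)|²` is integrable on `ω` for a.e.
`t`, `IsSuitablePairOn.ae_integrable_norm_sq`), which dominates the printed left-hand side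
`∫_ω φ|u|²(t) dx + 2ν ∫∫ φ|∇u|²` of ESS Def. 2.1 as soon as `|ω| ≥ 1` (the dissipation integral
is nonnegative); clauses (2.1)–(2.3) are identical. [cite: EscauriazaSereginSverak2003, Def. 2.1 (2.4)] -/
theorem IsSuitablePairOn.isESSSuitablePairOn (h : IsSuitablePairOn ω a b ν u p) (hν : 0 ≤ ν)
    (hω : volume (ω : Set E) ≠ ∞) (hω1 : 1 ≤ (volume (ω : Set E)).toReal) :
    IsESSSuitablePairOn ω a b ν u p := by
  obtain ⟨G, hG, hG2, hloc⟩ := h.localEnergy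
  refine ⟨h.energyClass, h.pressure, h.distributional, G, hG, hG2, ?_⟩
  filter_upwards [hloc, h.ae_integrable_norm_sq] with t ht hint φ hφ hφ0
  have key := ht φ hφ hφ0
  set I : ℝ := ∫ z in Ioo a t ×ˢ (ω : Set E), φ z.1 z.2 * frobeniusNormSq (G z.1 z.2)
    with hI
  have hI0 : 0 ≤ I :=
    integral_nonneg fun z => mul_nonneg (hφ0 _ _) (frobeniusNormSq_nonneg _)
  have hc0 : 0 ≤ 2 * ν * I := mul_nonneg (mul_nonneg zero_le_two hν) hI0
  -- the slice `x ↦ φ t x * ‖u t x‖²` is integrable on `ω`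
  obtain ⟨K, hK⟩ :=
    hφ.contDiff.continuous.bounded_above_of_compact_support hφ.hasCompactSupport
  have hφint : Integrable (fun x => φ t x * ‖u t x‖ ^ 2) (volume.restrict (ω : Set E)) :=
    hint.bdd_mul (hφ.contDiff_slice t).continuous.aestronglyMeasurable
      (Eventually.of_forall fun x => hK (t, x))
  haveI : IsFiniteMeasure (volume.restrict (ω : Set E)) := isFiniteMeasure_restrict.2 hω
  have hsplit : ∫ x in (ω : Set E), (φ t x * ‖u t x‖ ^ 2 + 2 * ν * I) =
      (∫ x in (ω : Set E), φ t x * ‖u t x‖ ^ 2) +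
        (volume (ω : Set E)).toReal * (2 * ν * I) := by
    rw [integral_add hφint (integrable_const _), setIntegral_const, smul_eq_mul, Measure.real]
  calc (∫ x in (ω : Set E), φ t x * ‖u t x‖ ^ 2) + 2 * ν * I
      ≤ (∫ x in (ω : Set E), φ t x * ‖u t x‖ ^ 2) +
          (volume (ω : Set E)).toReal * (2 * ν * I) :=
        add_le_add le_rfl (le_mul_of_one_le_left hc0 hω1)
    _ = ∫ x in (ω : Set E), (φ t x * ‖u t x‖ ^ 2 + 2 * ν * I) := hsplit.symm
    _ ≤ _ := key

end Comparison

/-- `|B(1)| = 4π/3 ≥ 1` in `ℝ³`. [folklore] -/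
theorem one_le_toReal_volume_unitBall :
    1 ≤ (volume ((unitBall : Opens (EuclideanSpace ℝ (Fin 3))) :
      Set (EuclideanSpace ℝ (Fin 3)))).toReal := by
  rw [coe_unitBall, EuclideanSpace.volume_ball_fin_three, ENNReal.ofReal_one, one_pow, one_mul,
    ENNReal.toReal_ofReal (by positivity)]
  nlinarith [Real.pi_gt_three]

/-- `|B(1)| < ∞` in `ℝ³`. [folklore] -/
theorem volume_unitBall_ne_top :
    volume ((unitBall : Opens (EuclideanSpace ℝ (Fin 3))) :
      Set (EuclideanSpace ℝ (Fin 3))) ≠ ∞ := by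
  rw [coe_unitBall]
  exact measure_ball_lt_top.ne

/-- On ESS's cylinder `Q = B × ]-1, 0[` (`ν = 1`) the mis-parenthesised predicate
`IsSuitablePairOn` implies the printed Def. 2.1, `IsESSSuitablePairOn` (`|B(1)| = 4π/3 ≥ 1`). [cite: EscauriazaSereginSverak2003, Def. 2.1] -/
theorem IsSuitablePairOn.isESSSuitablePairOn_unitBall
    {u : ℝ → EuclideanSpace ℝ (Fin 3) → EuclideanSpace ℝ (Fin 3)}
    {p : ℝ → EuclideanSpace ℝ (Fin 3) → ℝ} (h : IsSuitablePairOn unitBall (-1) 0 1 u p) :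
    IsESSSuitablePairOn unitBall (-1) 0 1 u p :=
  h.isESSSuitablePairOn zero_le_one volume_unitBall_ne_top one_le_toReal_volume_unitBall

/-- **`ess_epsilon_regularity` is a corollary of the faithful rendering
`ess_epsilon_regularity'` of ESS Lemma 2.2** (the hypothesis class of the unprimed fact is
contained in that of the primed one, `IsSuitablePairOn.isESSSuitablePairOn_unitBall`; the
conclusions are identical). This is the implication announced in the docstring of
`ess_epsilon_regularity` ("implied by the printed Lemma 2.2"). [cite: EscauriazaSereginSverak2003, Lemma 2.2] -/
theorem ess_epsilon_regularity_of' (h : ess_epsilon_regularity') : ess_epsilon_regularity := by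
  obtain ⟨ε₀, c₀, hε₀, hc₀, H⟩ := h
  exact ⟨ε₀, c₀, hε₀, hc₀, fun U P hUP hsmall =>
    H U P hUP.isESSSuitablePairOn_unitBall hsmall⟩

end Literature.Analysis.FluidPDE
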